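import Mathlib
import HarnessLib
import Summits.ResolutionOfSingularities.ResolutionOfSingularities.Theorems.WildQuotientsWildQuotientResolutionS1aMemberAwayRelations
import Summits.ResolutionOfSingularities.ResolutionOfSingularities.Theorems.WildQuotientsWildQuotientResolutionS1aFreeModelStep
import Summits.ResolutionOfSingularities.ResolutionOfSingularities.Theorems.WildQuotientsWildQuotientResolutionS1aQhSymChartIterates
import Summits.ResolutionOfSingularities.ResolutionOfSingularities.Theorems.WildQuotientsWildQuotientResolutionS1aQhSymChartNorms
import Summits.ResolutionOfSingularities.ResolutionOfSingularities.Theorems.WildQuotientsWildQuotientResolutionS1aCuspMemberZ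
import Summits.ResolutionOfSingularities.ResolutionOfSingularities.Theorems.WildQuotientsWildQuotientResolutionS1aChartBHat
import Summits.ResolutionOfSingularities.ResolutionOfSingularities.Theorems.WildQuotientsWildQuotientResolutionS1aAwayModelEquiv
import Summits.ResolutionOfSingularities.ResolutionOfSingularities.Theorems.WildQuotientsWildQuotientResolutionS1aCuspK1
import Summits.ResolutionOfSingularities.ResolutionOfSingularities.Theorems.WildQuotientsWildQuotientResolutionS1aCuspFLocus
import Summits.ResolutionOfSingularities.ResolutionOfSingularities.Theorems.WildQuotientsWildQuotientResolutionS1aA1Move2Model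

/-!
# S1a — R4c cusp, (b3) INSTANTIATION at `O` WITH RELATIONS: the member chart `U_O = [N(x₁)] ∩ D(N(x′₂)·N(h_O))` presented by sections `a, b` with `a·(π^*x₂|U)³ = π^*x₀|U`, `b·(π^*x₁|U)³ = π^*f|U` (supersedes ✓`exists_cuspO_memberChart`, which lacks the relations)

Recipe = first half of ✓`exists_graphTail_memberChart` (GraphTailMember) + ✓`exists_memberSections_away` with `DW :=` the producer node literal,
`Z := N_R(u₂′)·N_R(ĥ)` (✓CuspMemberZ), `b̂ := Z^{dbar}·c^{−6p}` (✓ChartBHat), `b′ := (ZP2·NHP)^{dbar}` (✓QhSymChartIterates), `Φ′` (✓AwayModelEquiv), rows ✓QhSymChartRows +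
✓`QhAway.qhc_row_three` (`subst_cuspTail`), `hq` ✓QhSymChartNorms + `qhc_row_subst`, K1′ ✓`isRegular_away_X_binomial23` (cert ✓`Cusp.prod_add_mul_mem_iff`), units by divisibility,
`u := X (some 2)` (`e = (3, 2)`), degrees ✓`qhc_degree_u'` / `qhc_degree_tail`. See `Lines/s1a_logminvertex-R4c-PROGRESS.md` §2 (2O), §4.
-/

set_option linter.dupNamespace false

noncomputable section

open CategoryTheory Limits AlgebraicGeometry TopologicalSpace Topology Opposite MvPolynomial
open Literature.AlgebraicGeometry.Resolution Literature.AlgebraicGeometry.RelativeSpec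
open scoped LaurentPolynomial
open Summit.ResolutionOfSingularities.ResolutionOfSingularities.Theorems.WildQuotientResolution.S1
open Summit.ResolutionOfSingularities.ResolutionOfSingularities.Theorems.WildQuotientResolution.S1.NodeAtlas
open Summit.ResolutionOfSingularities.ResolutionOfSingularities.Theorems.WildQuotientResolution.S1.ProducerStep
open Summit.ResolutionOfSingularities.ResolutionOfSingularities.Theorems.WildQuotientResolution.S1.CoarseChart
open Summit.ResolutionOfSingularities.ResolutionOfSingularities.Theorems.WildQuotientResolution.S1.ReesBigrading
open Summit.ResolutionOfSingularities.ResolutionOfSingularities.Theorems.WildQuotientResolution.S1.NodeTransport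
open Summit.ResolutionOfSingularities.ResolutionOfSingularities.Theorems.WildQuotientResolution.S1.CobordantTransport
open Summit.ResolutionOfSingularities.ResolutionOfSingularities.Theorems.WildQuotientResolution.S1.KillCert
open Summit.ResolutionOfSingularities.ResolutionOfSingularities.Theorems.WildQuotientResolution.S1.BlowupCharts
open Summit.ResolutionOfSingularities.ResolutionOfSingularities.Theorems.WildQuotientResolution.S1.NodeAway
open Summit.ResolutionOfSingularities.ResolutionOfSingularities.Theorems.WildQuotientResolution.S1.CentreAway
open Summit.ResolutionOfSingularities.ResolutionOfSingularities.Theorems.WildQuotientResolution.S1.FreeModel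
open Summit.ResolutionOfSingularities.ResolutionOfSingularities.Theorems.WildQuotientResolution.S1.NpFrame
open Summit.ResolutionOfSingularities.ResolutionOfSingularities.Theorems.WildQuotientResolution.S1.GameFrame.GModel

namespace Summit.ResolutionOfSingularities.ResolutionOfSingularities.Theorems.WildQuotientResolution.S1.GameFrame.GModel

variable {p : ℕ} {X' X₁ : Scheme.{0}} {q : X' ⟶ X₁} {G : Type} [Group G] {ρ : G →* Aut X'} {g₀ : G}

set_option maxHeartbeats 8000000 in
set_option synthInstance.maxHeartbeats 400000 in
/-- ★★ **R4c LEVEL 2 AT `O` — the cusp member on `U_O = [N(x₁)] ∩ D(b)`, presented by sections** (`a·(π^*x₂|U)³ = π^*x₀|U`, `b·(π^*x₁|U)³ = π^*f|U` for the given pulled-back root sections `r₀, r₁, r₂, r_t` of `W`). [OURS · L1 W4.5c · R4c (b3); NOT a statement of the manuscript] -/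
theorem exists_cuspO_memberChart_rel [Finite G] (hG : ∀ g : G, g ∈ Subgroup.zpowers g₀)
    {k : Type} [Field k] [Fact p.Prime] [CharP k p] (σ : (MvPolynomial (Fin 4) k) ≃+* (MvPolynomial (Fin 4) k)) (hC : ∀ a : k, σ (C a) = C a)
    (h0 : σ (X 0) = X 0) (h1 : σ (X 1) = X 1 + X 0) (h2 : σ (X 2) = X 2 + X 0) (h3 : σ (X 3) = X 3 + (X 2 ^ 2 - X 1 ^ 3))
    (a : k) (ha : a ≠ 0) (h2k : (2 : k) ≠ 0)
    (hh : (MvPolynomial (Fin 4) k)) (hhh : hh = ∏ l : ZMod p, (X 1 + C (-a) + (l.val : (MvPolynomial (Fin 4) k)) * X 0)) (hσh : σ hh = hh)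
    (hp : 0 < p) (hσpL : ∀ y : (Localization.Away hh), (⇑(sigmaAway σ hσh))^[p] y = y)
    (hσJ : ∀ n : ℕ, ((weightedFiltration (fun i => algebraMap (MvPolynomial (Fin 4) k) (Localization.Away hh) (X ((![0, 1, 2] : Fin 3 → Fin 4) i))) (![9, 2, 3] : Fin 3 → ℕ)).ideal n).map ((sigmaAway σ hσh) : (Localization.Away hh) →+* (Localization.Away hh)) ≤ (weightedFiltration (fun i => algebraMap (MvPolynomial (Fin 4) k) (Localization.Away hh) (X ((![0, 1, 2] : Fin 3 → Fin 4) i))) (![9, 2, 3] : Fin 3 → ℕ)).ideal n)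
    (ht : algebraMap (MvPolynomial (Fin 4) k) (Localization.Away hh) (X 2 ^ 2 - X 1 ^ 3) ∈ (weightedFiltration (fun i => algebraMap (MvPolynomial (Fin 4) k) (Localization.Away hh) (X ((![0, 1, 2] : Fin 3 → Fin 4) i))) (![9, 2, 3] : Fin 3 → ℕ)).ideal 6)
    {mg : ℕ} (mo : Fin mg → ℕ) (𝒜 : (Π j : Fin mg, ZMod (mo j)) → AddSubgroup (Localization.Away hh)) [GradedRing 𝒜] (hfull : ∀ (d : Π j : Fin mg, ZMod (mo j)) (x : (Localization.Away hh)), x ∈ 𝒜 d)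
    (hf : ∀ i, (fun i => algebraMap (MvPolynomial (Fin 4) k) (Localization.Away hh) (X ((![0, 1, 2] : Fin 3 → Fin 4) i))) i ∈ 𝒜 ((fun _ => (0 : Π j : Fin mg, ZMod (mo j))) i))
    {dbar : ℕ} (y : ↥(𝒜 0)) (hy : y ∈ (traceFiltration 𝒜 (fun i => algebraMap (MvPolynomial (Fin 4) k) (Localization.Away hh) (X ((![0, 1, 2] : Fin 3 → Fin 4) i))) (![9, 2, 3] : Fin 3 → ℕ)).ideal dbar) (hσy : (sigmaAway σ hσh) (y : (Localization.Away hh)) = y)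
    {n₁ : ℕ} (hn₁ : 0 < n₁)
    (hc1 : (coverElement 𝒜 (fun i => algebraMap (MvPolynomial (Fin 4) k) (Localization.Away hh) (X ((![0, 1, 2] : Fin 3 → Fin 4) i))) (![9, 2, 3] : Fin 3 → ℕ) dbar y hy) = (∏ l : ZMod p, ((cobordantAlgebra.u' (fun i => algebraMap (MvPolynomial (Fin 4) k) (Localization.Away hh) (X ((![0, 1, 2] : Fin 3 → Fin 4) i))) (![9, 2, 3] : Fin 3 → ℕ) 1) + algebraMap (Localization.Away hh) ↥(cobordantAlgebra (fun i => algebraMap (MvPolynomial (Fin 4) k) (Localization.Away hh) (X ((![0, 1, 2] : Fin 3 → Fin 4) i))) (![9, 2, 3] : Fin 3 → ℕ)) (l.val : (Localization.Away hh)) * ((cobordantAlgebra.u' (fun i => algebraMap (MvPolynomial (Fin 4) k) (Localization.Away hh) (X ((![0, 1, 2] : Fin 3 → Fin 4) i))) (![9, 2, 3] : Fin 3 → ℕ) 0) * (cobordantAlgebra.s (fun i => algebraMap (MvPolynomial (Fin 4) k) (Localization.Away hh) (X ((![0, 1, 2] : Fin 3 → Fin 4) i))) (![9, 2, 3] : Fin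 3 → ℕ)) ^ ((![9, 2, 3] : Fin 3 → ℕ) 0 - (![9, 2, 3] : Fin 3 → ℕ) 1)))) ^ n₁) (hdbar : 0 < dbar)
    (M : GModel p q G ρ g₀) [M.V.IsSeparated] (W : M.act.StableAffineOpens) (hW : IsAffineOpen W.1)
    (E : letI := chartNodeGradedRing mo 𝒜 (fun i => algebraMap (MvPolynomial (Fin 4) k) (Localization.Away hh) (X ((![0, 1, 2] : Fin 3 → Fin 4) i))) (![9, 2, 3] : Fin 3 → ℕ) hf dbar y hy; Γ(M.V, W.1) ≃+* ↥((chartNodeGrading mo 𝒜 (fun i => algebraMap (MvPolynomial (Fin 4) k) (Localization.Away hh) (X ((![0, 1, 2] : Fin 3 → Fin 4) i))) (![9, 2, 3] : Fin 3 → ℕ) hf dbar y hy) 0))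
    (htame : letI := chartNodeGradedRing mo 𝒜 (fun i => algebraMap (MvPolynomial (Fin 4) k) (Localization.Away hh) (X ((![0, 1, 2] : Fin 3 → Fin 4) i))) (![9, 2, 3] : Fin 3 → ℕ) hf dbar y hy; IsTameNode p (ChartRing 𝒜 (fun i => algebraMap (MvPolynomial (Fin 4) k) (Localization.Away hh) (X ((![0, 1, 2] : Fin 3 → Fin 4) i))) (![9, 2, 3] : Fin 3 → ℕ) dbar y hy) (chartNodeGrading mo 𝒜 (fun i => algebraMap (MvPolynomial (Fin 4) k) (Localization.Away hh) (X ((![0, 1, 2] : Fin 3 → Fin 4) i))) (![9, 2, 3] : Fin 3 → ℕ) hf dbar y hy) (sigmaChart 𝒜 (fun i => algebraMap (MvPolynomial (Fin 4) k) (Localization.Away hh) (X ((![0, 1, 2] : Fin 3 → Fin 4) i))) (![9, 2, 3] : Fin 3 → ℕ) dbar y hy (sigmaAway σ hσh) hσJ hp hσpL hσy))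
    (hE : letI := chartNodeGradedRing mo 𝒜 (fun i => algebraMap (MvPolynomial (Fin 4) k) (Localization.Away hh) (X ((![0, 1, 2] : Fin 3 → Fin 4) i))) (![9, 2, 3] : Fin 3 → ℕ) hf dbar y hy
      ∀ t' : Γ(M.V, W.1), ((E ((M.act.aut g₀⁻¹).hom.appLE W.1 W.1 (W.2.1 g₀⁻¹).ge t') : ↥((chartNodeGrading mo 𝒜 (fun i => algebraMap (MvPolynomial (Fin 4) k) (Localization.Away hh) (X ((![0, 1, 2] : Fin 3 → Fin 4) i))) (![9, 2, 3] : Fin 3 → ℕ) hf dbar y hy) 0)) : (ChartRing 𝒜 (fun i => algebraMap (MvPolynomial (Fin 4) k) (Localization.Away hh) (X ((![0, 1, 2] : Fin 3 → Fin 4) i))) (![9, 2, 3] : Fin 3 → ℕ) dbar y hy)) = (sigmaChart 𝒜 (fun i => algebraMap (MvPolynomial (Fin 4) k) (Localization.Away hh) (X ((![0, 1, 2] : Fin 3 → Fin 4) i))) (![9, 2, 3] : Fin 3 → ℕ) dbar y hy (sigmaAway σ hσh) hσJ hp hσpL hσy) ((E t' : ↥((chartNodeGrading mo 𝒜 (fun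 i => algebraMap (MvPolynomial (Fin 4) k) (Localization.Away hh) (X ((![0, 1, 2] : Fin 3 → Fin 4) i))) (![9, 2, 3] : Fin 3 → ℕ) hf dbar y hy) 0)) : (ChartRing 𝒜 (fun i => algebraMap (MvPolynomial (Fin 4) k) (Localization.Away hh) (X ((![0, 1, 2] : Fin 3 → Fin 4) i))) (![9, 2, 3] : Fin 3 → ℕ) dbar y hy)))
    -- the pulled-back root sections, by their chart values
    (r0 r1 r2 rt : Γ(M.V, W.1))
    (hr0 : letI := chartNodeGradedRing mo 𝒜 (fun i => algebraMap (MvPolynomial (Fin 4) k) (Localization.Away hh) (X ((![0, 1, 2] : Fin 3 → Fin 4) i))) (![9, 2, 3] : Fin 3 → ℕ) hf dbar y hy; ((E r0 : ↥((chartNodeGrading mo 𝒜 (fun i => algebraMap (MvPolynomial (Fin 4) k) (Localization.Away hh) (X ((![0, 1, 2] : Fin 3 → Fin 4) i))) (![9, 2, 3] : Fin 3 → ℕ) hf dbar y hy) 0)) : (ChartRing 𝒜 (fun i => algebraMap (MvPolynomial (Fin 4) k) (Localization.Away hh) (X ((![0, 1, 2] : Fin 3 → Fin 4) i))) (![9,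 2, 3] : Fin 3 → ℕ) dbar y hy)) = algebraMap ↥(cobordantAlgebra (fun i => algebraMap (MvPolynomial (Fin 4) k) (Localization.Away hh) (X ((![0, 1, 2] : Fin 3 → Fin 4) i))) (![9, 2, 3] : Fin 3 → ℕ)) (ChartRing 𝒜 (fun i => algebraMap (MvPolynomial (Fin 4) k) (Localization.Away hh) (X ((![0, 1, 2] : Fin 3 → Fin 4) i))) (![9, 2, 3] : Fin 3 → ℕ) dbar y hy) (algebraMap (Localization.Away hh) ↥(cobordantAlgebra (fun i => algebraMap (MvPolynomial (Fin 4) k) (Localization.Away hh) (X ((![0, 1, 2] : Fin 3 → Fin 4) i))) (![9, 2, 3] : Fin 3 → ℕ)) ((fun i => algebraMap (MvPolynomial (Fin 4) k) (Localization.Away hh) (X ((![0, 1, 2] : Fin 3 → Fin 4) i))) 0)))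
    (hr1 : letI := chartNodeGradedRing mo 𝒜 (fun i => algebraMap (MvPolynomial (Fin 4) k) (Localization.Away hh) (X ((![0, 1, 2] : Fin 3 → Fin 4) i))) (![9, 2, 3] : Fin 3 → ℕ) hf dbar y hy; ((E r1 : ↥((chartNodeGrading mo 𝒜 (fun i => algebraMap (MvPolynomial (Fin 4) k) (Localization.Away hh) (X ((![0, 1, 2] : Fin 3 → Fin 4) i))) (![9, 2, 3] : Fin 3 → ℕ) hf dbar y hy) 0)) : (ChartRing 𝒜 (fun i => algebraMap (MvPolynomial (Fin 4) k) (Localization.Away hh) (X ((![0, 1, 2] : Fin 3 → Fin 4) i))) (![9, 2, 3] : Fin 3 → ℕ) dbar y hy)) = algebraMap ↥(cobordantAlgebra (fun i => algebraMap (MvPolynomial (Fin 4) k) (Localization.Away hh) (X ((![0, 1, 2] : Fin 3 → Fin 4) i))) (![9, 2, 3] : Fin 3 → ℕ)) (ChartRing 𝒜 (fun i => algebraMap (MvPolynomial (Fin 4) k) (Localization.Away hh) (X ((![0, 1, 2] : Fin 3 → Fin 4) i))) (![9, 2, 3] : Fin 3 → ℕ) dbar y hy) (algebraMap (Localization.Away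 hh) ↥(cobordantAlgebra (fun i => algebraMap (MvPolynomial (Fin 4) k) (Localization.Away hh) (X ((![0, 1, 2] : Fin 3 → Fin 4) i))) (![9, 2, 3] : Fin 3 → ℕ)) ((fun i => algebraMap (MvPolynomial (Fin 4) k) (Localization.Away hh) (X ((![0, 1, 2] : Fin 3 → Fin 4) i))) 1)))
    (hr2 : letI := chartNodeGradedRing mo 𝒜 (fun i => algebraMap (MvPolynomial (Fin 4) k) (Localization.Away hh) (X ((![0, 1, 2] : Fin 3 → Fin 4) i))) (![9, 2, 3] : Fin 3 → ℕ) hf dbar y hy; ((E r2 : ↥((chartNodeGrading mo 𝒜 (fun i => algebraMap (MvPolynomial (Fin 4) k) (Localization.Away hh) (X ((![0, 1, 2] : Fin 3 → Fin 4) i))) (![9, 2, 3] : Fin 3 → ℕ) hf dbar y hy) 0)) : (ChartRing 𝒜 (fun i => algebraMap (MvPolynomial (Fin 4) k) (Localization.Away hh) (X ((![0, 1, 2] : Fin 3 → Fin 4) i))) (![9, 2, 3] : Fin 3 → ℕ) dbar y hy)) = algebraMap ↥(cobordantAlgebra (fun i => algebraMap (MvPolynomial (Fin 4) k) (Localization.Away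 hh) (X ((![0, 1, 2] : Fin 3 → Fin 4) i))) (![9, 2, 3] : Fin 3 → ℕ)) (ChartRing 𝒜 (fun i => algebraMap (MvPolynomial (Fin 4) k) (Localization.Away hh) (X ((![0, 1, 2] : Fin 3 → Fin 4) i))) (![9, 2, 3] : Fin 3 → ℕ) dbar y hy) (algebraMap (Localization.Away hh) ↥(cobordantAlgebra (fun i => algebraMap (MvPolynomial (Fin 4) k) (Localization.Away hh) (X ((![0, 1, 2] : Fin 3 → Fin 4) i))) (![9, 2, 3] : Fin 3 → ℕ)) ((fun i => algebraMap (MvPolynomial (Fin 4) k) (Localization.Away hh) (X ((![0, 1, 2] : Fin 3 → Fin 4) i))) 2)))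
    (hrt : letI := chartNodeGradedRing mo 𝒜 (fun i => algebraMap (MvPolynomial (Fin 4) k) (Localization.Away hh) (X ((![0, 1, 2] : Fin 3 → Fin 4) i))) (![9, 2, 3] : Fin 3 → ℕ) hf dbar y hy; ((E rt : ↥((chartNodeGrading mo 𝒜 (fun i => algebraMap (MvPolynomial (Fin 4) k) (Localization.Away hh) (X ((![0, 1, 2] : Fin 3 → Fin 4) i))) (![9, 2, 3] : Fin 3 → ℕ) hf dbar y hy) 0)) : (ChartRing 𝒜 (fun i => algebraMap (MvPolynomial (Fin 4) k) (Localization.Away hh) (X ((![0, 1, 2] : Fin 3 → Fin 4) i))) (![9, 2, 3] : Fin 3 → ℕ) dbar y hy)) = algebraMap ↥(cobordantAlgebra (fun i => algebraMap (MvPolynomial (Fin 4) k) (Localization.Away hh) (X ((![0, 1, 2] : Fin 3 → Fin 4) i))) (![9, 2, 3] : Fin 3 → ℕ)) (ChartRing 𝒜 (fun i => algebraMap (MvPolynomial (Fin 4) k) (Localization.Away hh) (X ((![0, 1, 2] : Fin 3 → Fin 4) i))) (![9, 2, 3] : Fin 3 → ℕ) dbar y hy) (algebraMap (Localization.Away hh)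 ↥(cobordantAlgebra (fun i => algebraMap (MvPolynomial (Fin 4) k) (Localization.Away hh) (X ((![0, 1, 2] : Fin 3 → Fin 4) i))) (![9, 2, 3] : Fin 3 → ℕ)) (algebraMap (MvPolynomial (Fin 4) k) (Localization.Away hh) (X 2 ^ 2 - X 1 ^ 3)))) :
    letI := chartNodeGradedRing mo 𝒜 (fun i => algebraMap (MvPolynomial (Fin 4) k) (Localization.Away hh) (X ((![0, 1, 2] : Fin 3 → Fin 4) i))) (![9, 2, 3] : Fin 3 → ℕ) hf dbar y hy
    ∃ (b : Γ(M.V, W.1)) (U : M.act.StableAffineOpens) (hUW : U.1 ≤ W.1) (_ : U.1 = M.V.basicOpen b),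
      ((E b : ↥((chartNodeGrading mo 𝒜 (fun i => algebraMap (MvPolynomial (Fin 4) k) (Localization.Away hh) (X ((![0, 1, 2] : Fin 3 → Fin 4) i))) (![9, 2, 3] : Fin 3 → ℕ) hf dbar y hy) 0)) : (ChartRing 𝒜 (fun i => algebraMap (MvPolynomial (Fin 4) k) (Localization.Away hh) (X ((![0, 1, 2] : Fin 3 → Fin 4) i))) (![9, 2, 3] : Fin 3 → ℕ) dbar y hy)) = algebraMap ↥(cobordantAlgebra (fun i => algebraMap (MvPolynomial (Fin 4) k) (Localization.Away hh) (X ((![0, 1, 2] : Fin 3 → Fin 4) i))) (![9, 2, 3] : Fin 3 → ℕ)) (ChartRing 𝒜 (fun i => algebraMap (MvPolynomial (Fin 4) k) (Localization.Away hh) (X ((![0, 1, 2] : Fin 3 → Fin 4) i))) (![9, 2, 3] : Fin 3 → ℕ) dbar y hy) (((∏ j : ZMod p, (⇑(sigmaR (sigmaAway σ hσh) (fun i => algebraMap (MvPolynomial (Fin 4) k) (Localization.Away hh) (X ((![0, 1, 2] : Fin 3 → Fin 4) i))) (![9, 2, 3] : Fin 3 → ℕ) hσJ hp hσpL))^[j.val]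 (cobordantAlgebra.u' (fun i => algebraMap (MvPolynomial (Fin 4) k) (Localization.Away hh) (X ((![0, 1, 2] : Fin 3 → Fin 4) i))) (![9, 2, 3] : Fin 3 → ℕ) 2)) * ∏ j : ZMod p, (⇑(sigmaR (sigmaAway σ hσh) (fun i => algebraMap (MvPolynomial (Fin 4) k) (Localization.Away hh) (X ((![0, 1, 2] : Fin 3 → Fin 4) i))) (![9, 2, 3] : Fin 3 → ℕ) hσJ hp hσpL))^[j.val] (2 * (cobordantAlgebra.u' (fun i => algebraMap (MvPolynomial (Fin 4) k) (Localization.Away hh) (X ((![0, 1, 2] : Fin 3 → Fin 4) i))) (![9, 2, 3] : Fin 3 → ℕ) 2) - 3 * (cobordantAlgebra.s (fun i => algebraMap (MvPolynomial (Fin 4) k) (Localization.Away hh) (X ((![0, 1, 2] : Fin 3 → Fin 4) i))) (![9, 2, 3] : Fin 3 → ℕ)) * (cobordantAlgebra.u' (fun i => algebraMap (MvPolynomial (Fin 4) k) (Localization.Away hh) (X ((![0, 1, 2] : Fin 3 → Fin 4) i))) (![9, 2, 3] : Fin 3 → ℕ) 1) ^ 2)) ^ dbar) *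
        IsLocalization.Away.invSelf (coverElement 𝒜 (fun i => algebraMap (MvPolynomial (Fin 4) k) (Localization.Away hh) (X ((![0, 1, 2] : Fin 3 → Fin 4) i))) (![9, 2, 3] : Fin 3 → ℕ) dbar y hy) ^ (3 * p + 3 * p) ∧
      ∃ (a' bb : Γ(M.V, U.1)),
        a' * (M.V.presheaf.map (homOfLE hUW).op).hom r2 ^ 3 = (M.V.presheaf.map (homOfLE hUW).op).hom r0 ∧
        bb * (M.V.presheaf.map (homOfLE hUW).op).hom r1 ^ 3 = (M.V.presheaf.map (homOfLE hUW).op).hom rt ∧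
        ∃ d₀ : ℕ, 0 < d₀ ∧ ∀ l : ℕ, 0 < l → ∃ 𝒦₀ : ReesFiltration M.V, IsPrincipalCentreChart p M.act g₀ 𝒦₀ (d₀ * l) U ∧
          ∀ (U' : M.V.affineOpens) (hU : U'.1 ≤ U.1) (n : ℕ), (𝒦₀.filtration U').ideal n =
            (weightedFiltration (fun l' => (M.V.presheaf.map (homOfLE hU).op).hom ((![a', bb] : Fin 2 → Γ(M.V, U.1)) l')) ![2, 1]).ideal n := by
  classical
  letI instN := chartNodeGradedRing mo 𝒜 (fun i => algebraMap (MvPolynomial (Fin 4) k) (Localization.Away hh) (X ((![0, 1, 2] : Fin 3 → Fin 4) i))) (![9, 2, 3] : Fin 3 → ℕ) hf dbar y hy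
  haveI : NeZero p := ⟨hp.ne'⟩
  have hp1 : p ≠ 1 := (Fact.out : p.Prime).ne_one
  have hw1 : (![9, 2, 3] : Fin 3 → ℕ) 1 + 6 ≤ (![9, 2, 3] : Fin 3 → ℕ) 0 := by decide
  have hw2 : (![9, 2, 3] : Fin 3 → ℕ) 0 = (![9, 2, 3] : Fin 3 → ℕ) 2 + 6 := by decide
  have he1 : (![9, 2, 3] : Fin 3 → ℕ) 0 - ((![9, 2, 3] : Fin 3 → ℕ) 1 + 6) = 1 := by decide
  have he7 : (![9, 2, 3] : Fin 3 → ℕ) 0 - (![9, 2, 3] : Fin 3 → ℕ) 1 = 7 := by decide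
  -- ### the pinned free model of the producer chart ring
  have hvW : ∀ i : Fin 3, (![9, 2, 3, 0] : Fin 4 → ℕ) ((![0, 1, 2] : Fin 3 → Fin 4) i) = (![9, 2, 3] : Fin 3 → ℕ) i := fun i => by fin_cases i <;> rfl
  have hWv : ∀ l : Fin 4, (![9, 2, 3, 0] : Fin 4 → ℕ) l = 0 ∨ ∃ i : Fin 3, (![0, 1, 2] : Fin 3 → Fin 4) i = l := fun l => by
    fin_cases l
    exacts [Or.inr ⟨0, rfl⟩, Or.inr ⟨1, rfl⟩, Or.inr ⟨2, rfl⟩, Or.inl rfl]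
  have hz : ∀ Ψ : ↥(cobordantAlgebra (fun i => algebraMap (MvPolynomial (Fin 4) k) (Localization.Away hh) (X ((![0, 1, 2] : Fin 3 → Fin 4) i))) (![9, 2, 3] : Fin 3 → ℕ)) ≃+* Localization.Away (cobordantAlgebra.subst k (![9, 2, 3, 0] : Fin 4 → ℕ) hh),
      (∀ a : (MvPolynomial (Fin 4) k), Ψ (algebraMap (Localization.Away hh) ↥(cobordantAlgebra (fun i => algebraMap (MvPolynomial (Fin 4) k) (Localization.Away hh) (X ((![0, 1, 2] : Fin 3 → Fin 4) i))) (![9, 2, 3] : Fin 3 → ℕ)) (algebraMap (MvPolynomial (Fin 4) k) (Localization.Away hh) a)) = algebraMap (MvPolynomial (Option (Fin 4)) k) _ (cobordantAlgebra.subst k (![9, 2, 3, 0] : Fin 4 → ℕ) a)) →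
      Ψ (cobordantAlgebra.s (fun i => algebraMap (MvPolynomial (Fin 4) k) (Localization.Away hh) (X ((![0, 1, 2] : Fin 3 → Fin 4) i))) (![9, 2, 3] : Fin 3 → ℕ)) = algebraMap (MvPolynomial (Option (Fin 4)) k) _ (X none) →
      (∀ i, Ψ (cobordantAlgebra.u' (fun i => algebraMap (MvPolynomial (Fin 4) k) (Localization.Away hh) (X ((![0, 1, 2] : Fin 3 → Fin 4) i))) (![9, 2, 3] : Fin 3 → ℕ) i) = algebraMap (MvPolynomial (Option (Fin 4)) k) _ (X (some ((![0, 1, 2] : Fin 3 → Fin 4) i)))) →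
      Associated (algebraMap (MvPolynomial (Option (Fin 4)) k) (Localization.Away (cobordantAlgebra.subst k (![9, 2, 3, 0] : Fin 4 → ℕ) hh)) ((∏ l : ZMod p, (X (some 1) + (l.val : (MvPolynomial (Option (Fin 4)) k)) * (X none ^ 6 * (X (some 0) * X none ^ ((![9, 2, 3] : Fin 3 → ℕ) 0 - ((![9, 2, 3] : Fin 3 → ℕ) 1 + 6)))))) ^ n₁)) (Ψ (coverElement 𝒜 (fun i => algebraMap (MvPolynomial (Fin 4) k) (Localization.Away hh) (X ((![0, 1, 2] : Fin 3 → Fin 4) i))) (![9, 2, 3] : Fin 3 → ℕ) dbar y hy)) := by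
    intro Ψ hΨa hΨs hΨu
    have heq : Ψ (coverElement 𝒜 (fun i => algebraMap (MvPolynomial (Fin 4) k) (Localization.Away hh) (X ((![0, 1, 2] : Fin 3 → Fin 4) i))) (![9, 2, 3] : Fin 3 → ℕ) dbar y hy) = algebraMap (MvPolynomial (Option (Fin 4)) k) (Localization.Away (cobordantAlgebra.subst k (![9, 2, 3, 0] : Fin 4 → ℕ) hh)) ((∏ l : ZMod p, (X (some 1) + (l.val : (MvPolynomial (Option (Fin 4)) k)) * (X none ^ 6 * (X (some 0) * X none ^ ((![9, 2, 3] : Fin 3 → ℕ) 0 - ((![9, 2, 3] : Fin 3 → ℕ) 1 + 6)))))) ^ n₁) := by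
      rw [hc1, map_pow, map_prod, map_pow, map_prod]
      refine congrArg (· ^ n₁) (Finset.prod_congr rfl fun l _ => ?_)
      rw [map_add, map_mul, map_mul, map_pow, hΨu 1, hΨu 0, hΨs, map_natCast, map_add, map_mul, map_mul, map_mul, map_pow, map_pow, map_natCast, he1, he7]
      simp only [Matrix.cons_val_one, Matrix.cons_val_zero, map_natCast]
      ring
    rw [heq]
  obtain ⟨Φ, hΦa, hΦs, hΦu⟩ := FreeModel.exists_chartFreeModelEquiv k (![9, 2, 3, 0] : Fin 4 → ℕ) hh (![0, 1, 2] : Fin 3 → Fin 4) (![9, 2, 3] : Fin 3 → ℕ) hvW hWv (fun i => algebraMap (MvPolynomial (Fin 4) k) (Localization.Away hh) (X ((![0, 1, 2] : Fin 3 → Fin 4) i))) (fun _ => rfl) 𝒜 dbar y hy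
    ((∏ l : ZMod p, (X (some 1) + (l.val : (MvPolynomial (Option (Fin 4)) k)) * (X none ^ 6 * (X (some 0) * X none ^ ((![9, 2, 3] : Fin 3 → ℕ) 0 - ((![9, 2, 3] : Fin 3 → ℕ) 1 + 6)))))) ^ n₁) hz
  -- ### `subst hh`, the `k`-point, `q ≠ 0`
  have hsubX : ∀ i : Fin 4, cobordantAlgebra.subst k (![9, 2, 3, 0] : Fin 4 → ℕ) (X i) = X none ^ (![9, 2, 3, 0] : Fin 4 → ℕ) i * X (some i) := fun i => by
    rw [cobordantAlgebra.subst, MvPolynomial.eval₂Hom_X']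
  have hsubC : ∀ a' : k, cobordantAlgebra.subst k (![9, 2, 3, 0] : Fin 4 → ℕ) (C a') = C a' := fun a' => by rw [cobordantAlgebra.subst, MvPolynomial.eval₂Hom_C]
  have hsubst_hh : cobordantAlgebra.subst k (![9, 2, 3, 0] : Fin 4 → ℕ) hh = ∏ l : ZMod p, (X none ^ 2 * X (some 1) + C (-a) + (l.val : (MvPolynomial (Option (Fin 4)) k)) * (X none ^ 9 * X (some 0))) := by
    rw [hhh, map_prod]
    refine Finset.prod_congr rfl fun l _ => ?_
    rw [map_add, map_add, map_mul, map_natCast, hsubX, hsubX, hsubC]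
    rfl
  -- the `k`-point `(s; x′₀, x′₁, x′₂, x₃) = (0; 0, 1, 1, 0)` and `q·b′ ≠ 0`
  have hupt : MvPolynomial.eval (fun o : Option (Fin 4) => o.elim (0 : k) ![0, 1, 1, 0]) ((cobordantAlgebra.subst k (![9, 2, 3, 0] : Fin 4 → ℕ) hh * (∏ l : ZMod p, (X (some 1) + (l.val : (MvPolynomial (Option (Fin 4)) k)) * (X none ^ 6 * (X (some 0) * X none ^ ((![9, 2, 3] : Fin 3 → ℕ) 0 - ((![9, 2, 3] : Fin 3 → ℕ) 1 + 6)))))) ^ n₁) * (((∏ l : ZMod p, (X (some 2) + (l.val : (MvPolynomial (Option (Fin 4)) k)) * (X none ^ 6 * X (some 0)))) * (∏ l : ZMod p, (2 * (X (some 2) + (l.val : (MvPolynomial (Option (Fin 4)) k)) * (X none ^ 6 * X (some 0))) - 3 * X none * (X (some 1) + (l.val : (MvPolynomial (Option (Fin 4)) k)) * (X none ^ 6 * (X (some 0) * X none ^ ((![9, 2, 3] : Fin 3 → ℕ) 0 - ((![9, 2, 3] : Fin 3 → ℕ) 1 + 6))))) ^ 2))) ^ dbar)) ≠ 0 := by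
    rw [map_mul, map_mul, map_pow, hsubst_hh, map_pow, map_mul]
    simp only [map_prod, map_add, map_sub, map_mul, map_pow, map_natCast, map_neg, MvPolynomial.eval_X, MvPolynomial.eval_C, map_ofNat,
      Option.elim_none, Option.elim_some, Matrix.cons_val_zero, Matrix.cons_val_one, Matrix.cons_val_two,
      ne_eq, zero_pow (Nat.succ_ne_zero _), mul_zero, add_zero, zero_add, mul_one, one_pow, Finset.prod_const, Finset.card_univ, ZMod.card]
    have hv : Matrix.vecHead (Matrix.vecTail (![1, 1, 0] : Fin 3 → k)) = 1 := rfl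
    rw [hv, one_pow, one_mul, mul_one, sub_zero]
    exact mul_ne_zero (pow_ne_zero _ (neg_ne_zero.mpr ha)) (pow_ne_zero _ (pow_ne_zero _ h2k))
  have hq0 : (cobordantAlgebra.subst k (![9, 2, 3, 0] : Fin 4 → ℕ) hh * (∏ l : ZMod p, (X (some 1) + (l.val : (MvPolynomial (Option (Fin 4)) k)) * (X none ^ 6 * (X (some 0) * X none ^ ((![9, 2, 3] : Fin 3 → ℕ) 0 - ((![9, 2, 3] : Fin 3 → ℕ) 1 + 6)))))) ^ n₁) * (((∏ l : ZMod p, (X (some 2) + (l.val : (MvPolynomial (Option (Fin 4)) k)) * (X none ^ 6 * X (some 0)))) * (∏ l : ZMod p, (2 * (X (some 2) + (l.val : (MvPolynomial (Option (Fin 4)) k)) * (X none ^ 6 * X (some 0))) - 3 * X none * (X (some 1) + (l.val : (MvPolynomial (Option (Fin 4)) k)) * (X none ^ 6 * (X (some 0) * X none ^ ((![9, 2, 3] : Fin 3 → ℕ) 0 - ((![9, 2, 3] : Fin 3 → ℕ) 1 + 6))))) ^ 2))) ^ dbar) ≠ 0 := fun h => hupt (by rw [h, map_zero])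
  have hQD0 : (cobordantAlgebra.subst k (![9, 2, 3, 0] : Fin 4 → ℕ) hh * (∏ l : ZMod p, (X (some 1) + (l.val : (MvPolynomial (Option (Fin 4)) k)) * (X none ^ 6 * (X (some 0) * X none ^ ((![9, 2, 3] : Fin 3 → ℕ) 0 - ((![9, 2, 3] : Fin 3 → ℕ) 1 + 6)))))) ^ n₁) ≠ 0 := left_ne_zero_of_mul hq0
  haveI : CharP (Localization.Away (cobordantAlgebra.subst k (![9, 2, 3, 0] : Fin 4 → ℕ) hh * (∏ l : ZMod p, (X (some 1) + (l.val : (MvPolynomial (Option (Fin 4)) k)) * (X none ^ 6 * (X (some 0) * X none ^ ((![9, 2, 3] : Fin 3 → ℕ) 0 - ((![9, 2, 3] : Fin 3 → ℕ) 1 + 6)))))) ^ n₁)) p := charP_of_injective_ringHom (IsLocalization.injective (Localization.Away (cobordantAlgebra.subst k (![9, 2, 3, 0] : Fin 4 → ℕ) hh * (∏ l : ZMod p, (X (some 1) + (l.val : (MvPolynomial (Option (Fin 4)) k)) * (X none ^ 6 * (X (some 0) * X none ^ ((![9, 2, 3] : Fin 3 → ℕ) 0 - ((![9, 2, 3] :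 Fin 3 → ℕ) 1 + 6)))))) ^ n₁)) (powers_le_nonZeroDivisors_of_noZeroDivisors hQD0)) p
  -- ### rows of `τ′ = conj Φ σ_chart` in the producer model; `τ′` fixes `q` and `b′`
  obtain ⟨rn, row0, rC⟩ := KillCert.QhSym.qsc_rows_fixed σ hC h0 h1 h2 (X 2 ^ 2 - X 1 ^ 3) h3 (![9, 2, 3] : Fin 3 → ℕ) hh hσh hp hσpL hσJ mo 𝒜 y hy hσy Φ hΦa hΦs hΦu
  have row1 := KillCert.QhSym.qsc_row_one σ h0 h1 h2 (X 2 ^ 2 - X 1 ^ 3) h3 (![9, 2, 3] : Fin 3 → ℕ) 6 hw1 hh hσh hp hσpL hσJ mo 𝒜 y hy hσy Φ hΦs hΦu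
  have row2 := KillCert.QhSym.qsc_row_two σ h0 h1 h2 (X 2 ^ 2 - X 1 ^ 3) h3 (![9, 2, 3] : Fin 3 → ℕ) 6 hw2 hh hσh hp hσpL hσJ mo 𝒜 y hy hσy Φ hΦs hΦu
  have hT' : cobordantAlgebra.subst k (![9, 2, 3, 0] : Fin 4 → ℕ) (X 2 ^ 2 - X 1 ^ 3 : (MvPolynomial (Fin 4) k)) = X none ^ 6 * (X (some 2) ^ 2 - X (some 1) ^ 3 : MvPolynomial (Option (Fin 4)) k) := KillCert.QhSym.subst_cuspTail (k := k)
  have row3 := KillCert.QhAway.qhc_row_three σ (X 2 ^ 2 - X 1 ^ 3) h3 (![9, 2, 3] : Fin 3 → ℕ) 6 hh hσh hp hσpL hσJ mo 𝒜 y hy hσy Φ hΦa (X (some 2) ^ 2 - X (some 1) ^ 3 : MvPolynomial (Option (Fin 4)) k) hT'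
  have hφeq := KillCert.QhAway.qhc_tail_eq (X 2 ^ 2 - X 1 ^ 3) (![9, 2, 3] : Fin 3 → ℕ) 6 hh mo 𝒜 y hy hQD0 Φ hΦa hΦs ht (X (some 2) ^ 2 - X (some 1) ^ 3 : MvPolynomial (Option (Fin 4)) k) hT'
  have hrs : conj Φ (sigmaChart 𝒜 (fun i => algebraMap (MvPolynomial (Fin 4) k) (Localization.Away hh) (X ((![0, 1, 2] : Fin 3 → Fin 4) i))) (![9, 2, 3] : Fin 3 → ℕ) dbar y hy (sigmaAway σ hσh) hσJ hp hσpL hσy) ((algebraMap (MvPolynomial (Option (Fin 4)) k) (Localization.Away (cobordantAlgebra.subst k (![9, 2, 3, 0] : Fin 4 → ℕ) hh * (∏ l : ZMod p, (X (some 1) + (l.val : (MvPolynomial (Option (Fin 4)) k)) * (X none ^ 6 * (X (some 0) * X none ^ ((![9, 2, 3] : Fin 3 → ℕ) 0 - ((![9, 2, 3] : Fin 3 → ℕ) 1 + 6)))))) ^ n₁))) (cobordantAlgebra.subst k (![9, 2, 3, 0] : Fin 4 → ℕ) hh)) = (algebraMap (MvPolynomial (Option (Fin 4)) k) (Localization.Away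 (cobordantAlgebra.subst k (![9, 2, 3, 0] : Fin 4 → ℕ) hh * (∏ l : ZMod p, (X (some 1) + (l.val : (MvPolynomial (Option (Fin 4)) k)) * (X none ^ 6 * (X (some 0) * X none ^ ((![9, 2, 3] : Fin 3 → ℕ) 0 - ((![9, 2, 3] : Fin 3 → ℕ) 1 + 6)))))) ^ n₁))) (cobordantAlgebra.subst k (![9, 2, 3, 0] : Fin 4 → ℕ) hh) :=
    KillCert.QhAway.qhc_row_subst σ (![9, 2, 3] : Fin 3 → ℕ) hh hσh hp hσpL hσJ mo 𝒜 y hy hσy Φ hΦa hh hσh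
  have hZP1fix := KillCert.QhSym.qsc_normX1_fixed σ hC h0 h1 h2 (X 2 ^ 2 - X 1 ^ 3) h3 (![9, 2, 3] : Fin 3 → ℕ) 6 hw1 hh hσh hp hσpL hσJ mo 𝒜 y hy hσy Φ hΦa hΦs hΦu hp1
  have hZP2fix := KillCert.QhSym.qsc_normX2_fixed σ hC h0 h1 h2 (X 2 ^ 2 - X 1 ^ 3) h3 (![9, 2, 3] : Fin 3 → ℕ) 6 hw2 hh hσh hp hσpL hσJ mo 𝒜 y hy hσy Φ hΦa hΦs hΦu hp1
  have hNHfix := KillCert.QhSym.qsc_normH_fixed σ hC h0 h1 h2 (X 2 ^ 2 - X 1 ^ 3) h3 (![9, 2, 3] : Fin 3 → ℕ) 6 hw1 hw2 hh hσh hp hσpL hσJ mo 𝒜 y hy hσy Φ hΦa hΦs hΦu hp1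
  have hτq : conj Φ (sigmaChart 𝒜 (fun i => algebraMap (MvPolynomial (Fin 4) k) (Localization.Away hh) (X ((![0, 1, 2] : Fin 3 → Fin 4) i))) (![9, 2, 3] : Fin 3 → ℕ) dbar y hy (sigmaAway σ hσh) hσJ hp hσpL hσy) ((algebraMap (MvPolynomial (Option (Fin 4)) k) (Localization.Away (cobordantAlgebra.subst k (![9, 2, 3, 0] : Fin 4 → ℕ) hh * (∏ l : ZMod p, (X (some 1) + (l.val : (MvPolynomial (Option (Fin 4)) k)) * (X none ^ 6 * (X (some 0) * X none ^ ((![9, 2, 3] : Fin 3 → ℕ) 0 - ((![9, 2, 3] : Fin 3 → ℕ) 1 + 6)))))) ^ n₁))) ((cobordantAlgebra.subst k (![9, 2, 3, 0] : Fin 4 → ℕ) hh * (∏ l : ZMod p, (X (some 1) + (l.val : (MvPolynomial (Option (Fin 4)) k)) * (X none ^ 6 * (X (some 0) * X none ^ ((![9, 2, 3] : Fin 3 → ℕ) 0 - ((![9, 2, 3] : Fin 3 → ℕ) 1 + 6)))))) ^ n₁) * (((∏ l : ZMod p, (X (some 2) + (l.val : (MvPolynomial (Option (Fin 4)) k)) *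 (X none ^ 6 * X (some 0)))) * (∏ l : ZMod p, (2 * (X (some 2) + (l.val : (MvPolynomial (Option (Fin 4)) k)) * (X none ^ 6 * X (some 0))) - 3 * X none * (X (some 1) + (l.val : (MvPolynomial (Option (Fin 4)) k)) * (X none ^ 6 * (X (some 0) * X none ^ ((![9, 2, 3] : Fin 3 → ℕ) 0 - ((![9, 2, 3] : Fin 3 → ℕ) 1 + 6))))) ^ 2))) ^ dbar))) = (algebraMap (MvPolynomial (Option (Fin 4)) k) (Localization.Away (cobordantAlgebra.subst k (![9, 2, 3, 0] : Fin 4 → ℕ) hh * (∏ l : ZMod p, (X (some 1) + (l.val : (MvPolynomial (Option (Fin 4)) k)) * (X none ^ 6 * (X (some 0) * X none ^ ((![9, 2, 3] : Fin 3 → ℕ) 0 - ((![9, 2, 3] : Fin 3 → ℕ) 1 + 6)))))) ^ n₁))) ((cobordantAlgebra.subst k (![9, 2, 3, 0] : Fin 4 → ℕ) hh * (∏ l : ZMod p, (X (some 1) + (l.val : (MvPolynomial (Option (Fin 4)) k)) * (X none ^ 6 * (X (some 0) * X none ^ ((![9, 2, 3] : Fin 3 → ℕ) 0 - ((![9, 2,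 3] : Fin 3 → ℕ) 1 + 6)))))) ^ n₁) * (((∏ l : ZMod p, (X (some 2) + (l.val : (MvPolynomial (Option (Fin 4)) k)) * (X none ^ 6 * X (some 0)))) * (∏ l : ZMod p, (2 * (X (some 2) + (l.val : (MvPolynomial (Option (Fin 4)) k)) * (X none ^ 6 * X (some 0))) - 3 * X none * (X (some 1) + (l.val : (MvPolynomial (Option (Fin 4)) k)) * (X none ^ 6 * (X (some 0) * X none ^ ((![9, 2, 3] : Fin 3 → ℕ) 0 - ((![9, 2, 3] : Fin 3 → ℕ) 1 + 6))))) ^ 2))) ^ dbar)) := by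
    simp only [map_mul, map_pow, hrs, hZP1fix, hZP2fix, hNHfix]
  -- ### `Z = N_R(u₂′)·N_R(ĥ)`: fixed, bihomogeneous of bidegree `(6p, 0)`, with polynomial image `ZP2·NHP`
  have hσ𝒜 : ∀ (i : Π j : Fin mg, ZMod (mo j)) (x : (Localization.Away hh)), x ∈ 𝒜 i → (sigmaAway σ hσh) x ∈ 𝒜 i := fun i x _ => hfull i _
  have hZfix : (sigmaR (sigmaAway σ hσh) (fun i => algebraMap (MvPolynomial (Fin 4) k) (Localization.Away hh) (X ((![0, 1, 2] : Fin 3 → Fin 4) i))) (![9, 2, 3] : Fin 3 → ℕ) hσJ hp hσpL) ((∏ j : ZMod p, (⇑(sigmaR (sigmaAway σ hσh) (fun i => algebraMap (MvPolynomial (Fin 4) k) (Localization.Away hh) (X ((![0, 1, 2] : Fin 3 → Fin 4) i))) (![9, 2, 3] : Fin 3 → ℕ) hσJ hp hσpL))^[j.val] (cobordantAlgebra.u' (fun i => algebraMap (MvPolynomial (Fin 4) k) (Localization.Away hh) (X ((![0, 1, 2] : Fin 3 → Fin 4) i))) (![9, 2, 3] : Fin 3 → ℕ) 2)) * ∏ j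 : ZMod p, (⇑(sigmaR (sigmaAway σ hσh) (fun i => algebraMap (MvPolynomial (Fin 4) k) (Localization.Away hh) (X ((![0, 1, 2] : Fin 3 → Fin 4) i))) (![9, 2, 3] : Fin 3 → ℕ) hσJ hp hσpL))^[j.val] (2 * (cobordantAlgebra.u' (fun i => algebraMap (MvPolynomial (Fin 4) k) (Localization.Away hh) (X ((![0, 1, 2] : Fin 3 → Fin 4) i))) (![9, 2, 3] : Fin 3 → ℕ) 2) - 3 * (cobordantAlgebra.s (fun i => algebraMap (MvPolynomial (Fin 4) k) (Localization.Away hh) (X ((![0, 1, 2] : Fin 3 → Fin 4) i))) (![9, 2, 3] : Fin 3 → ℕ)) * (cobordantAlgebra.u' (fun i => algebraMap (MvPolynomial (Fin 4) k) (Localization.Away hh) (X ((![0, 1, 2] : Fin 3 → Fin 4) i))) (![9, 2, 3] : Fin 3 → ℕ) 1) ^ 2 : ↥(cobordantAlgebra (fun i => algebraMap (MvPolynomial (Fin 4) k) (Localization.Away hh) (X ((![0, 1, 2] : Fin 3 → Fin 4) i))) (![9, 2, 3] : Fin 3 → ℕ)))) = ((∏ j : ZMod p, (⇑(sigmaR (sigmaAway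 σ hσh) (fun i => algebraMap (MvPolynomial (Fin 4) k) (Localization.Away hh) (X ((![0, 1, 2] : Fin 3 → Fin 4) i))) (![9, 2, 3] : Fin 3 → ℕ) hσJ hp hσpL))^[j.val] (cobordantAlgebra.u' (fun i => algebraMap (MvPolynomial (Fin 4) k) (Localization.Away hh) (X ((![0, 1, 2] : Fin 3 → Fin 4) i))) (![9, 2, 3] : Fin 3 → ℕ) 2)) * ∏ j : ZMod p, (⇑(sigmaR (sigmaAway σ hσh) (fun i => algebraMap (MvPolynomial (Fin 4) k) (Localization.Away hh) (X ((![0, 1, 2] : Fin 3 → Fin 4) i))) (![9, 2, 3] : Fin 3 → ℕ) hσJ hp hσpL))^[j.val] (2 * (cobordantAlgebra.u' (fun i => algebraMap (MvPolynomial (Fin 4) k) (Localization.Away hh) (X ((![0, 1, 2] : Fin 3 → Fin 4) i))) (![9, 2, 3] : Fin 3 → ℕ) 2) - 3 * (cobordantAlgebra.s (fun i => algebraMap (MvPolynomial (Fin 4) k) (Localization.Away hh) (X ((![0, 1, 2] : Fin 3 → Fin 4) i))) (![9, 2, 3] : Fin 3 → ℕ)) * (cobordantAlgebra.u' (fun i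 => algebraMap (MvPolynomial (Fin 4) k) (Localization.Away hh) (X ((![0, 1, 2] : Fin 3 → Fin 4) i))) (![9, 2, 3] : Fin 3 → ℕ) 1) ^ 2 : ↥(cobordantAlgebra (fun i => algebraMap (MvPolynomial (Fin 4) k) (Localization.Away hh) (X ((![0, 1, 2] : Fin 3 → Fin 4) i))) (![9, 2, 3] : Fin 3 → ℕ)))) := KillCert.QhSym.sigmaR_normR_mul_fixed (sigmaAway σ hσh) (fun i => algebraMap (MvPolynomial (Fin 4) k) (Localization.Away hh) (X ((![0, 1, 2] : Fin 3 → Fin 4) i))) (![9, 2, 3] : Fin 3 → ℕ) hp hσpL hσJ (cobordantAlgebra.u' (fun i => algebraMap (MvPolynomial (Fin 4) k) (Localization.Away hh) (X ((![0, 1, 2] : Fin 3 → Fin 4) i))) (![9, 2, 3] : Fin 3 → ℕ) 2) (2 * (cobordantAlgebra.u' (fun i => algebraMap (MvPolynomial (Fin 4) k) (Localization.Away hh) (X ((![0, 1, 2] : Fin 3 → Fin 4) i))) (![9, 2, 3] : Fin 3 → ℕ) 2) - 3 * (cobordantAlgebra.s (fun i => algebraMap (MvPolynomial (Fin 4) k)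 (Localization.Away hh) (X ((![0, 1, 2] : Fin 3 → Fin 4) i))) (![9, 2, 3] : Fin 3 → ℕ)) * (cobordantAlgebra.u' (fun i => algebraMap (MvPolynomial (Fin 4) k) (Localization.Away hh) (X ((![0, 1, 2] : Fin 3 → Fin 4) i))) (![9, 2, 3] : Fin 3 → ℕ) 1) ^ 2 : ↥(cobordantAlgebra (fun i => algebraMap (MvPolynomial (Fin 4) k) (Localization.Away hh) (X ((![0, 1, 2] : Fin 3 → Fin 4) i))) (![9, 2, 3] : Fin 3 → ℕ)))
  have hU2deg : (cobordantAlgebra.u' (fun i => algebraMap (MvPolynomial (Fin 4) k) (Localization.Away hh) (X ((![0, 1, 2] : Fin 3 → Fin 4) i))) (![9, 2, 3] : Fin 3 → ℕ) 2) ∈ reesPiece 𝒜 (fun i => algebraMap (MvPolynomial (Fin 4) k) (Localization.Away hh) (X ((![0, 1, 2] : Fin 3 → Fin 4) i))) (![9, 2, 3] : Fin 3 → ℕ) ((((3 : ℕ)) : ℤ), (0 : Π j : Fin mg, ZMod (mo j))) := u'_mem_reesPiece 𝒜 (fun i => algebraMap (MvPolynomial (Fin 4) k) (Localization.Away hh)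 (X ((![0, 1, 2] : Fin 3 → Fin 4) i))) (δ := fun _ => (0 : Π j : Fin mg, ZMod (mo j))) (![9, 2, 3] : Fin 3 → ℕ) hf 2
  have hHHdeg : (2 * (cobordantAlgebra.u' (fun i => algebraMap (MvPolynomial (Fin 4) k) (Localization.Away hh) (X ((![0, 1, 2] : Fin 3 → Fin 4) i))) (![9, 2, 3] : Fin 3 → ℕ) 2) - 3 * (cobordantAlgebra.s (fun i => algebraMap (MvPolynomial (Fin 4) k) (Localization.Away hh) (X ((![0, 1, 2] : Fin 3 → Fin 4) i))) (![9, 2, 3] : Fin 3 → ℕ)) * (cobordantAlgebra.u' (fun i => algebraMap (MvPolynomial (Fin 4) k) (Localization.Away hh) (X ((![0, 1, 2] : Fin 3 → Fin 4) i))) (![9, 2, 3] : Fin 3 → ℕ) 1) ^ 2 : ↥(cobordantAlgebra (fun i => algebraMap (MvPolynomial (Fin 4) k) (Localization.Away hh) (X ((![0, 1, 2] : Fin 3 → Fin 4) i))) (![9, 2, 3] : Fin 3 → ℕ))) ∈ reesPiece 𝒜 (fun i => algebraMap (MvPolynomial (Fin 4) k) (Localization.Away hh) (X ((![0, 1, 2]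 : Fin 3 → Fin 4) i))) (![9, 2, 3] : Fin 3 → ℕ) ((((3 : ℕ)) : ℤ), (0 : Π j : Fin mg, ZMod (mo j))) := KillCert.QhSym.hHat_mem_reesPiece (fun i => algebraMap (MvPolynomial (Fin 4) k) (Localization.Away hh) (X ((![0, 1, 2] : Fin 3 → Fin 4) i))) (![9, 2, 3] : Fin 3 → ℕ) mo 𝒜 hf rfl rfl
  have hN2deg := KillCert.QhSym.normR_mem_reesPiece (sigmaAway σ hσh) (fun i => algebraMap (MvPolynomial (Fin 4) k) (Localization.Away hh) (X ((![0, 1, 2] : Fin 3 → Fin 4) i))) (![9, 2, 3] : Fin 3 → ℕ) hp hσpL hσJ mo 𝒜 hσ𝒜 hf hU2deg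
  have hNHdeg := KillCert.QhSym.normR_mem_reesPiece (sigmaAway σ hσh) (fun i => algebraMap (MvPolynomial (Fin 4) k) (Localization.Away hh) (X ((![0, 1, 2] : Fin 3 → Fin 4) i))) (![9, 2, 3] : Fin 3 → ℕ) hp hσpL hσJ mo 𝒜 hσ𝒜 hf hHHdeg
  have hZdeg : ((∏ j : ZMod p, (⇑(sigmaR (sigmaAway σ hσh) (fun i => algebraMap (MvPolynomial (Fin 4) k) (Localization.Away hh) (X ((![0, 1, 2] : Fin 3 → Fin 4) i))) (![9, 2, 3] : Fin 3 → ℕ) hσJ hp hσpL))^[j.val] (cobordantAlgebra.u' (fun i => algebraMap (MvPolynomial (Fin 4) k) (Localization.Away hh) (X ((![0, 1, 2] : Fin 3 → Fin 4) i))) (![9, 2, 3] : Fin 3 → ℕ) 2)) * ∏ j : ZMod p, (⇑(sigmaR (sigmaAway σ hσh) (fun i => algebraMap (MvPolynomial (Fin 4) k) (Localization.Away hh) (X ((![0, 1, 2] : Fin 3 → Fin 4) i))) (![9, 2, 3] : Fin 3 → ℕ) hσJ hp hσpL))^[j.val] (2 * (cobordantAlgebra.u' (fun i => algebraMap (MvPolynomial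 (Fin 4) k) (Localization.Away hh) (X ((![0, 1, 2] : Fin 3 → Fin 4) i))) (![9, 2, 3] : Fin 3 → ℕ) 2) - 3 * (cobordantAlgebra.s (fun i => algebraMap (MvPolynomial (Fin 4) k) (Localization.Away hh) (X ((![0, 1, 2] : Fin 3 → Fin 4) i))) (![9, 2, 3] : Fin 3 → ℕ)) * (cobordantAlgebra.u' (fun i => algebraMap (MvPolynomial (Fin 4) k) (Localization.Away hh) (X ((![0, 1, 2] : Fin 3 → Fin 4) i))) (![9, 2, 3] : Fin 3 → ℕ) 1) ^ 2 : ↥(cobordantAlgebra (fun i => algebraMap (MvPolynomial (Fin 4) k) (Localization.Away hh) (X ((![0, 1, 2] : Fin 3 → Fin 4) i))) (![9, 2, 3] : Fin 3 → ℕ)))) ∈ reesPiece 𝒜 (fun i => algebraMap (MvPolynomial (Fin 4) k) (Localization.Away hh) (X ((![0, 1, 2] : Fin 3 → Fin 4) i))) (![9, 2, 3] : Fin 3 → ℕ) ((((3 * p + 3 * p : ℕ)) : ℤ), (0 : Π j : Fin mg, ZMod (mo j))) := by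
    letI := reesGradedRing 𝒜 (fun i => algebraMap (MvPolynomial (Fin 4) k) (Localization.Away hh) (X ((![0, 1, 2] : Fin 3 → Fin 4) i))) (![9, 2, 3] : Fin 3 → ℕ) hf
    have h := SetLike.mul_mem_graded hN2deg hNHdeg
    rwa [Prod.mk_add_mk, add_zero, ← Nat.cast_add] at h
  have hb0 := FreeModel.bHat_mem_chartNodeGrading_zero mo 𝒜 (fun i => algebraMap (MvPolynomial (Fin 4) k) (Localization.Away hh) (X ((![0, 1, 2] : Fin 3 → Fin 4) i))) (![9, 2, 3] : Fin 3 → ℕ) hf dbar y hy ((∏ j : ZMod p, (⇑(sigmaR (sigmaAway σ hσh) (fun i => algebraMap (MvPolynomial (Fin 4) k) (Localization.Away hh) (X ((![0, 1, 2] : Fin 3 → Fin 4) i))) (![9, 2, 3] : Fin 3 → ℕ) hσJ hp hσpL))^[j.val] (cobordantAlgebra.u' (fun i => algebraMap (MvPolynomial (Fin 4) k) (Localization.Away hh) (X ((![0, 1, 2] : Fin 3 → Fin 4) i))) (![9, 2, 3] : Fin 3 → ℕ) 2)) * ∏ j : ZMod p, (⇑(sigmaR (sigmaAway σ hσh) (fun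 i => algebraMap (MvPolynomial (Fin 4) k) (Localization.Away hh) (X ((![0, 1, 2] : Fin 3 → Fin 4) i))) (![9, 2, 3] : Fin 3 → ℕ) hσJ hp hσpL))^[j.val] (2 * (cobordantAlgebra.u' (fun i => algebraMap (MvPolynomial (Fin 4) k) (Localization.Away hh) (X ((![0, 1, 2] : Fin 3 → Fin 4) i))) (![9, 2, 3] : Fin 3 → ℕ) 2) - 3 * (cobordantAlgebra.s (fun i => algebraMap (MvPolynomial (Fin 4) k) (Localization.Away hh) (X ((![0, 1, 2] : Fin 3 → Fin 4) i))) (![9, 2, 3] : Fin 3 → ℕ)) * (cobordantAlgebra.u' (fun i => algebraMap (MvPolynomial (Fin 4) k) (Localization.Away hh) (X ((![0, 1, 2] : Fin 3 → Fin 4) i))) (![9, 2, 3] : Fin 3 → ℕ) 1) ^ 2 : ↥(cobordantAlgebra (fun i => algebraMap (MvPolynomial (Fin 4) k) (Localization.Away hh) (X ((![0, 1, 2] : Fin 3 → Fin 4) i))) (![9, 2, 3] : Fin 3 → ℕ)))) (3 * p + 3 * p) hZdeg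
  have hσbH := FreeModel.sigmaChart_bHat mo 𝒜 (fun i => algebraMap (MvPolynomial (Fin 4) k) (Localization.Away hh) (X ((![0, 1, 2] : Fin 3 → Fin 4) i))) (![9, 2, 3] : Fin 3 → ℕ) dbar y hy ((∏ j : ZMod p, (⇑(sigmaR (sigmaAway σ hσh) (fun i => algebraMap (MvPolynomial (Fin 4) k) (Localization.Away hh) (X ((![0, 1, 2] : Fin 3 → Fin 4) i))) (![9, 2, 3] : Fin 3 → ℕ) hσJ hp hσpL))^[j.val] (cobordantAlgebra.u' (fun i => algebraMap (MvPolynomial (Fin 4) k) (Localization.Away hh) (X ((![0, 1, 2] : Fin 3 → Fin 4) i))) (![9, 2, 3] : Fin 3 → ℕ) 2)) * ∏ j : ZMod p, (⇑(sigmaR (sigmaAway σ hσh) (fun i => algebraMap (MvPolynomial (Fin 4) k) (Localization.Away hh) (X ((![0, 1, 2] : Fin 3 → Fin 4) i))) (![9, 2, 3] : Fin 3 → ℕ) hσJ hp hσpL))^[j.val] (2 * (cobordantAlgebra.u' (fun i => algebraMap (MvPolynomial (Fin 4) k) (Localization.Away hh) (X ((![0, 1, 2] : Fin 3 → Fin 4)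 i))) (![9, 2, 3] : Fin 3 → ℕ) 2) - 3 * (cobordantAlgebra.s (fun i => algebraMap (MvPolynomial (Fin 4) k) (Localization.Away hh) (X ((![0, 1, 2] : Fin 3 → Fin 4) i))) (![9, 2, 3] : Fin 3 → ℕ)) * (cobordantAlgebra.u' (fun i => algebraMap (MvPolynomial (Fin 4) k) (Localization.Away hh) (X ((![0, 1, 2] : Fin 3 → Fin 4) i))) (![9, 2, 3] : Fin 3 → ℕ) 1) ^ 2 : ↥(cobordantAlgebra (fun i => algebraMap (MvPolynomial (Fin 4) k) (Localization.Away hh) (X ((![0, 1, 2] : Fin 3 → Fin 4) i))) (![9, 2, 3] : Fin 3 → ℕ)))) (3 * p + 3 * p) (sigmaAway σ hσh) hσJ hp hσpL hσy hZfix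
  have hΦZ : Φ ((algebraMap ↥(cobordantAlgebra (fun i => algebraMap (MvPolynomial (Fin 4) k) (Localization.Away hh) (X ((![0, 1, 2] : Fin 3 → Fin 4) i))) (![9, 2, 3] : Fin 3 → ℕ)) (ChartRing 𝒜 (fun i => algebraMap (MvPolynomial (Fin 4) k) (Localization.Away hh) (X ((![0, 1, 2] : Fin 3 → Fin 4) i))) (![9, 2, 3] : Fin 3 → ℕ) dbar y hy)) ((∏ j : ZMod p, (⇑(sigmaR (sigmaAway σ hσh) (fun i => algebraMap (MvPolynomial (Fin 4) k) (Localization.Away hh) (X ((![0, 1, 2] : Fin 3 → Fin 4) i))) (![9, 2, 3] : Fin 3 → ℕ) hσJ hp hσpL))^[j.val] (cobordantAlgebra.u' (fun i => algebraMap (MvPolynomial (Fin 4) k) (Localization.Away hh) (X ((![0, 1, 2] : Fin 3 → Fin 4) i))) (![9, 2, 3] : Fin 3 → ℕ) 2)) * ∏ j : ZMod p, (⇑(sigmaR (sigmaAway σ hσh) (fun i => algebraMap (MvPolynomial (Fin 4) k) (Localization.Away hh) (X ((![0, 1, 2] : Fin 3 → Fin 4) i))) (![9, 2, 3] : Fin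 3 → ℕ) hσJ hp hσpL))^[j.val] (2 * (cobordantAlgebra.u' (fun i => algebraMap (MvPolynomial (Fin 4) k) (Localization.Away hh) (X ((![0, 1, 2] : Fin 3 → Fin 4) i))) (![9, 2, 3] : Fin 3 → ℕ) 2) - 3 * (cobordantAlgebra.s (fun i => algebraMap (MvPolynomial (Fin 4) k) (Localization.Away hh) (X ((![0, 1, 2] : Fin 3 → Fin 4) i))) (![9, 2, 3] : Fin 3 → ℕ)) * (cobordantAlgebra.u' (fun i => algebraMap (MvPolynomial (Fin 4) k) (Localization.Away hh) (X ((![0, 1, 2] : Fin 3 → Fin 4) i))) (![9, 2, 3] : Fin 3 → ℕ) 1) ^ 2 : ↥(cobordantAlgebra (fun i => algebraMap (MvPolynomial (Fin 4) k) (Localization.Away hh) (X ((![0, 1, 2] : Fin 3 → Fin 4) i))) (![9, 2, 3] : Fin 3 → ℕ))))) = (algebraMap (MvPolynomial (Option (Fin 4)) k) (Localization.Away (cobordantAlgebra.subst k (![9, 2, 3, 0] : Fin 4 → ℕ) hh * (∏ l : ZMod p, (X (some 1) + (l.val : (MvPolynomial (Option (Fin 4)) k)) * (X none ^ 6 * (X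 (some 0) * X none ^ ((![9, 2, 3] : Fin 3 → ℕ) 0 - ((![9, 2, 3] : Fin 3 → ℕ) 1 + 6)))))) ^ n₁))) ((∏ l : ZMod p, (X (some 2) + (l.val : (MvPolynomial (Option (Fin 4)) k)) * (X none ^ 6 * X (some 0)))) * (∏ l : ZMod p, (2 * (X (some 2) + (l.val : (MvPolynomial (Option (Fin 4)) k)) * (X none ^ 6 * X (some 0))) - 3 * X none * (X (some 1) + (l.val : (MvPolynomial (Option (Fin 4)) k)) * (X none ^ 6 * (X (some 0) * X none ^ ((![9, 2, 3] : Fin 3 → ℕ) 0 - ((![9, 2, 3] : Fin 3 → ℕ) 1 + 6))))) ^ 2))) := by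
    rw [map_mul ((algebraMap ↥(cobordantAlgebra (fun i => algebraMap (MvPolynomial (Fin 4) k) (Localization.Away hh) (X ((![0, 1, 2] : Fin 3 → Fin 4) i))) (![9, 2, 3] : Fin 3 → ℕ)) (ChartRing 𝒜 (fun i => algebraMap (MvPolynomial (Fin 4) k) (Localization.Away hh) (X ((![0, 1, 2] : Fin 3 → Fin 4) i))) (![9, 2, 3] : Fin 3 → ℕ) dbar y hy))), map_mul Φ, map_mul ((algebraMap (MvPolynomial (Option (Fin 4)) k) (Localization.Away (cobordantAlgebra.subst k (![9, 2, 3, 0] : Fin 4 → ℕ) hh * (∏ l : ZMod p, (X (some 1) + (l.val : (MvPolynomial (Option (Fin 4)) k)) * (X none ^ 6 * (X (some 0) * X none ^ ((![9, 2, 3] : Fin 3 → ℕ) 0 - ((![9, 2, 3] : Fin 3 → ℕ) 1 + 6)))))) ^ n₁)))),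
      KillCert.QhSym.qsc_map_normR_u2 σ hC h0 h1 h2 (X 2 ^ 2 - X 1 ^ 3) h3 (![9, 2, 3] : Fin 3 → ℕ) 6 hw2 hh hσh hp hσpL hσJ mo 𝒜 y hy hσy Φ hΦa hΦs hΦu,
      KillCert.QhSym.qsc_map_normR_hHat σ hC h0 h1 h2 (X 2 ^ 2 - X 1 ^ 3) h3 (![9, 2, 3] : Fin 3 → ℕ) 6 hw1 hw2 hh hσh hp hσpL hσJ mo 𝒜 y hy hσy Φ hΦa hΦs hΦu]
  -- the section `b` with chart value `b̂`
  obtain ⟨b, hb⟩ : ∃ b : Γ(M.V, W.1), b = E.symm ⟨_, hb0⟩ := ⟨_, rfl⟩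
  have hEb : ((E b : ↥((chartNodeGrading mo 𝒜 (fun i => algebraMap (MvPolynomial (Fin 4) k) (Localization.Away hh) (X ((![0, 1, 2] : Fin 3 → Fin 4) i))) (![9, 2, 3] : Fin 3 → ℕ) hf dbar y hy) 0)) : (ChartRing 𝒜 (fun i => algebraMap (MvPolynomial (Fin 4) k) (Localization.Away hh) (X ((![0, 1, 2] : Fin 3 → Fin 4) i))) (![9, 2, 3] : Fin 3 → ℕ) dbar y hy)) = (algebraMap ↥(cobordantAlgebra (fun i => algebraMap (MvPolynomial (Fin 4) k) (Localization.Away hh) (X ((![0, 1, 2] : Fin 3 → Fin 4) i))) (![9, 2, 3] : Fin 3 → ℕ)) (ChartRing 𝒜 (fun i => algebraMap (MvPolynomial (Fin 4) k) (Localization.Away hh) (X ((![0, 1, 2] : Fin 3 → Fin 4) i))) (![9, 2, 3] : Fin 3 → ℕ) dbar y hy)) (((∏ j : ZMod p, (⇑(sigmaR (sigmaAway σ hσh) (fun i => algebraMap (MvPolynomial (Fin 4) k) (Localization.Away hh) (X ((![0, 1, 2] : Fin 3 → Fin 4) i))) (![9, 2, 3] : Fin 3 → ℕ) hσJ hp hσpL))^[j.val]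 (cobordantAlgebra.u' (fun i => algebraMap (MvPolynomial (Fin 4) k) (Localization.Away hh) (X ((![0, 1, 2] : Fin 3 → Fin 4) i))) (![9, 2, 3] : Fin 3 → ℕ) 2)) * ∏ j : ZMod p, (⇑(sigmaR (sigmaAway σ hσh) (fun i => algebraMap (MvPolynomial (Fin 4) k) (Localization.Away hh) (X ((![0, 1, 2] : Fin 3 → Fin 4) i))) (![9, 2, 3] : Fin 3 → ℕ) hσJ hp hσpL))^[j.val] (2 * (cobordantAlgebra.u' (fun i => algebraMap (MvPolynomial (Fin 4) k) (Localization.Away hh) (X ((![0, 1, 2] : Fin 3 → Fin 4) i))) (![9, 2, 3] : Fin 3 → ℕ) 2) - 3 * (cobordantAlgebra.s (fun i => algebraMap (MvPolynomial (Fin 4) k) (Localization.Away hh) (X ((![0, 1, 2] : Fin 3 → Fin 4) i))) (![9, 2, 3] : Fin 3 → ℕ)) * (cobordantAlgebra.u' (fun i => algebraMap (MvPolynomial (Fin 4) k) (Localization.Away hh) (X ((![0, 1, 2] : Fin 3 → Fin 4) i))) (![9, 2, 3] : Fin 3 → ℕ) 1) ^ 2 : ↥(cobordantAlgebra (fun i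 => algebraMap (MvPolynomial (Fin 4) k) (Localization.Away hh) (X ((![0, 1, 2] : Fin 3 → Fin 4) i))) (![9, 2, 3] : Fin 3 → ℕ)))) ^ dbar) * IsLocalization.Away.invSelf (coverElement 𝒜 (fun i => algebraMap (MvPolynomial (Fin 4) k) (Localization.Away hh) (X ((![0, 1, 2] : Fin 3 → Fin 4) i))) (![9, 2, 3] : Fin 3 → ℕ) dbar y hy) ^ (3 * p + 3 * p) := by rw [hb, E.apply_symm_apply]
  have hσbE : (sigmaChart 𝒜 (fun i => algebraMap (MvPolynomial (Fin 4) k) (Localization.Away hh) (X ((![0, 1, 2] : Fin 3 → Fin 4) i))) (![9, 2, 3] : Fin 3 → ℕ) dbar y hy (sigmaAway σ hσh) hσJ hp hσpL hσy) ((E b : ↥((chartNodeGrading mo 𝒜 (fun i => algebraMap (MvPolynomial (Fin 4) k) (Localization.Away hh) (X ((![0, 1, 2] : Fin 3 → Fin 4) i))) (![9, 2, 3] : Fin 3 → ℕ) hf dbar y hy) 0)) : (ChartRing 𝒜 (fun i => algebraMap (MvPolynomial (Fin 4) k) (Localization.Away hh) (X ((![0, 1, 2] : Fin 3 → Fin 4)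 i))) (![9, 2, 3] : Fin 3 → ℕ) dbar y hy)) = ((E b : ↥((chartNodeGrading mo 𝒜 (fun i => algebraMap (MvPolynomial (Fin 4) k) (Localization.Away hh) (X ((![0, 1, 2] : Fin 3 → Fin 4) i))) (![9, 2, 3] : Fin 3 → ℕ) hf dbar y hy) 0)) : (ChartRing 𝒜 (fun i => algebraMap (MvPolynomial (Fin 4) k) (Localization.Away hh) (X ((![0, 1, 2] : Fin 3 → Fin 4) i))) (![9, 2, 3] : Fin 3 → ℕ) dbar y hy)) := by rw [hEb]; exact hσbH
  have hΦb : Associated (Φ ((E b : ↥((chartNodeGrading mo 𝒜 (fun i => algebraMap (MvPolynomial (Fin 4) k) (Localization.Away hh) (X ((![0, 1, 2] : Fin 3 → Fin 4) i))) (![9, 2, 3] : Fin 3 → ℕ) hf dbar y hy) 0)) : (ChartRing 𝒜 (fun i => algebraMap (MvPolynomial (Fin 4) k) (Localization.Away hh) (X ((![0, 1, 2] : Fin 3 → Fin 4) i))) (![9, 2, 3] : Fin 3 → ℕ) dbar y hy))) ((algebraMap (MvPolynomial (Option (Fin 4)) k) (Localization.Away (cobordantAlgebra.subst k (![9, 2,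 3, 0] : Fin 4 → ℕ) hh * (∏ l : ZMod p, (X (some 1) + (l.val : (MvPolynomial (Option (Fin 4)) k)) * (X none ^ 6 * (X (some 0) * X none ^ ((![9, 2, 3] : Fin 3 → ℕ) 0 - ((![9, 2, 3] : Fin 3 → ℕ) 1 + 6)))))) ^ n₁))) (((∏ l : ZMod p, (X (some 2) + (l.val : (MvPolynomial (Option (Fin 4)) k)) * (X none ^ 6 * X (some 0)))) * (∏ l : ZMod p, (2 * (X (some 2) + (l.val : (MvPolynomial (Option (Fin 4)) k)) * (X none ^ 6 * X (some 0))) - 3 * X none * (X (some 1) + (l.val : (MvPolynomial (Option (Fin 4)) k)) * (X none ^ 6 * (X (some 0) * X none ^ ((![9, 2, 3] : Fin 3 → ℕ) 0 - ((![9, 2, 3] : Fin 3 → ℕ) 1 + 6))))) ^ 2))) ^ dbar)) := by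
    rw [hEb, map_pow ((algebraMap (MvPolynomial (Option (Fin 4)) k) (Localization.Away (cobordantAlgebra.subst k (![9, 2, 3, 0] : Fin 4 → ℕ) hh * (∏ l : ZMod p, (X (some 1) + (l.val : (MvPolynomial (Option (Fin 4)) k)) * (X none ^ 6 * (X (some 0) * X none ^ ((![9, 2, 3] : Fin 3 → ℕ) 0 - ((![9, 2, 3] : Fin 3 → ℕ) 1 + 6)))))) ^ n₁))))]
    exact FreeModel.associated_map_bHat mo 𝒜 (fun i => algebraMap (MvPolynomial (Fin 4) k) (Localization.Away hh) (X ((![0, 1, 2] : Fin 3 → Fin 4) i))) (![9, 2, 3] : Fin 3 → ℕ) dbar y hy ((∏ j : ZMod p, (⇑(sigmaR (sigmaAway σ hσh) (fun i => algebraMap (MvPolynomial (Fin 4) k) (Localization.Away hh) (X ((![0, 1, 2] : Fin 3 → Fin 4) i))) (![9, 2, 3] : Fin 3 → ℕ) hσJ hp hσpL))^[j.val] (cobordantAlgebra.u' (fun i => algebraMap (MvPolynomial (Fin 4) k) (Localization.Away hh) (X ((![0, 1, 2] : Fin 3 → Fin 4) i))) (![9, 2, 3] : Fin 3 → ℕ)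 2)) * ∏ j : ZMod p, (⇑(sigmaR (sigmaAway σ hσh) (fun i => algebraMap (MvPolynomial (Fin 4) k) (Localization.Away hh) (X ((![0, 1, 2] : Fin 3 → Fin 4) i))) (![9, 2, 3] : Fin 3 → ℕ) hσJ hp hσpL))^[j.val] (2 * (cobordantAlgebra.u' (fun i => algebraMap (MvPolynomial (Fin 4) k) (Localization.Away hh) (X ((![0, 1, 2] : Fin 3 → Fin 4) i))) (![9, 2, 3] : Fin 3 → ℕ) 2) - 3 * (cobordantAlgebra.s (fun i => algebraMap (MvPolynomial (Fin 4) k) (Localization.Away hh) (X ((![0, 1, 2] : Fin 3 → Fin 4) i))) (![9, 2, 3] : Fin 3 → ℕ)) * (cobordantAlgebra.u' (fun i => algebraMap (MvPolynomial (Fin 4) k) (Localization.Away hh) (X ((![0, 1, 2] : Fin 3 → Fin 4) i))) (![9, 2, 3] : Fin 3 → ℕ) 1) ^ 2 : ↥(cobordantAlgebra (fun i => algebraMap (MvPolynomial (Fin 4) k) (Localization.Away hh) (X ((![0, 1, 2] : Fin 3 → Fin 4) i))) (![9, 2, 3] : Fin 3 → ℕ)))) (3 * p + 3 * p) Φ 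hΦZ
  obtain ⟨Φ', hpin, hpin2⟩ := FreeModel.exists_awayModelEquiv (cobordantAlgebra.subst k (![9, 2, 3, 0] : Fin 4 → ℕ) hh * (∏ l : ZMod p, (X (some 1) + (l.val : (MvPolynomial (Option (Fin 4)) k)) * (X none ^ 6 * (X (some 0) * X none ^ ((![9, 2, 3] : Fin 3 → ℕ) 0 - ((![9, 2, 3] : Fin 3 → ℕ) 1 + 6)))))) ^ n₁) Φ ((E b : ↥((chartNodeGrading mo 𝒜 (fun i => algebraMap (MvPolynomial (Fin 4) k) (Localization.Away hh) (X ((![0, 1, 2] : Fin 3 → Fin 4) i))) (![9, 2, 3] : Fin 3 → ℕ) hf dbar y hy) 0)) : (ChartRing 𝒜 (fun i => algebraMap (MvPolynomial (Fin 4) k) (Localization.Away hh) (X ((![0, 1, 2] : Fin 3 → Fin 4) i))) (![9, 2, 3] : Fin 3 → ℕ) dbar y hy)) (((∏ l : ZMod p, (X (some 2) + (l.val : (MvPolynomial (Option (Fin 4)) k)) * (X none ^ 6 * X (some 0)))) * (∏ l : ZMod p, (2 * (X (some 2) + (l.val : (MvPolynomial (Option (Fin 4)) k)) * (X none ^ 6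 * X (some 0))) - 3 * X none * (X (some 1) + (l.val : (MvPolynomial (Option (Fin 4)) k)) * (X none ^ 6 * (X (some 0) * X none ^ ((![9, 2, 3] : Fin 3 → ℕ) 0 - ((![9, 2, 3] : Fin 3 → ℕ) 1 + 6))))) ^ 2))) ^ dbar) hΦb
  -- ### K1′ of `(x′₀, φ)` on the localised model (Jacobian certificate `2x′₂`, `x′₂ ∣ b′`)
  have hZP2eq : (∏ l : ZMod p, (X (some 2) + (l.val : (MvPolynomial (Option (Fin 4)) k)) * (X none ^ 6 * X (some 0)))) = ∏ l : ZMod p, (X (some 2) + (l.val : (MvPolynomial (Option (Fin 4)) k)) * X none ^ 6 * X (some 0)) := Finset.prod_congr rfl fun l _ => by ring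
  have hZP2dvd : (∏ l : ZMod p, (X (some 2) + (l.val : (MvPolynomial (Option (Fin 4)) k)) * (X none ^ 6 * X (some 0)))) ∣ (cobordantAlgebra.subst k (![9, 2, 3, 0] : Fin 4 → ℕ) hh * (∏ l : ZMod p, (X (some 1) + (l.val : (MvPolynomial (Option (Fin 4)) k)) * (X none ^ 6 * (X (some 0) * X none ^ ((![9, 2, 3] : Fin 3 → ℕ) 0 - ((![9, 2, 3] : Fin 3 → ℕ) 1 + 6)))))) ^ n₁) * (((∏ l : ZMod p, (X (some 2) + (l.val : (MvPolynomial (Option (Fin 4)) k)) * (X none ^ 6 * X (some 0)))) * (∏ l : ZMod p, (2 * (X (some 2) + (l.val : (MvPolynomial (Option (Fin 4)) k)) * (X none ^ 6 * X (some 0))) - 3 * X none * (X (some 1) + (l.val : (MvPolynomial (Option (Fin 4)) k)) * (X none ^ 6 * (X (some 0) * X none ^ ((![9, 2, 3] : Fin 3 → ℕ) 0 - ((![9, 2, 3] : Fin 3 → ℕ) 1 + 6))))) ^ 2))) ^ dbar) := ((dvd_mul_right (∏ l : ZMod p, (X (some 2) + (l.val : (MvPolynomial (Option (Fin 4)) k))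 * (X none ^ 6 * X (some 0)))) (∏ l : ZMod p, (2 * (X (some 2) + (l.val : (MvPolynomial (Option (Fin 4)) k)) * (X none ^ 6 * X (some 0))) - 3 * X none * (X (some 1) + (l.val : (MvPolynomial (Option (Fin 4)) k)) * (X none ^ 6 * (X (some 0) * X none ^ ((![9, 2, 3] : Fin 3 → ℕ) 0 - ((![9, 2, 3] : Fin 3 → ℕ) 1 + 6))))) ^ 2))).trans (dvd_pow_self _ hdbar.ne')).trans (dvd_mul_left _ _)
  have hX2 : ∀ Q : Ideal (MvPolynomial (Option (Fin 4)) k), Q.IsPrime → (X (some 0) : (MvPolynomial (Option (Fin 4)) k)) ∈ Q → (cobordantAlgebra.subst k (![9, 2, 3, 0] : Fin 4 → ℕ) hh * (∏ l : ZMod p, (X (some 1) + (l.val : (MvPolynomial (Option (Fin 4)) k)) * (X none ^ 6 * (X (some 0) * X none ^ ((![9, 2, 3] : Fin 3 → ℕ) 0 - ((![9, 2, 3] : Fin 3 → ℕ) 1 + 6)))))) ^ n₁) * (((∏ l : ZMod p, (X (some 2) + (l.val : (MvPolynomial (Option (Fin 4)) k)) * (X none ^ 6 * X (some 0)))) * (∏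 l : ZMod p, (2 * (X (some 2) + (l.val : (MvPolynomial (Option (Fin 4)) k)) * (X none ^ 6 * X (some 0))) - 3 * X none * (X (some 1) + (l.val : (MvPolynomial (Option (Fin 4)) k)) * (X none ^ 6 * (X (some 0) * X none ^ ((![9, 2, 3] : Fin 3 → ℕ) 0 - ((![9, 2, 3] : Fin 3 → ℕ) 1 + 6))))) ^ 2))) ^ dbar) ∉ Q → (X (some 2) : (MvPolynomial (Option (Fin 4)) k)) ∉ Q := by
    intro Q hQ hX0 hq hX2
    refine hq ?_
    obtain ⟨c', hc'⟩ := hZP2dvd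
    rw [hc']
    refine Q.mul_mem_right _ ?_
    rw [hZP2eq]
    exact (Cusp.prod_add_mul_mem_iff Q (X (some 2)) (X (some 0)) (fun l : ZMod p => (l.val : (MvPolynomial (Option (Fin 4)) k)) * X none ^ 6) hX0).mpr hX2
  obtain ⟨hK1, hK1'⟩ := FreeModel.isRegular_away_X_binomial23 ((cobordantAlgebra.subst k (![9, 2, 3, 0] : Fin 4 → ℕ) hh * (∏ l : ZMod p, (X (some 1) + (l.val : (MvPolynomial (Option (Fin 4)) k)) * (X none ^ 6 * (X (some 0) * X none ^ ((![9, 2, 3] : Fin 3 → ℕ) 0 - ((![9, 2, 3] : Fin 3 → ℕ) 1 + 6)))))) ^ n₁) * (((∏ l : ZMod p, (X (some 2) + (l.val : (MvPolynomial (Option (Fin 4)) k)) * (X none ^ 6 * X (some 0)))) * (∏ l : ZMod p, (2 * (X (some 2) + (l.val : (MvPolynomial (Option (Fin 4)) k)) * (X none ^ 6 * X (some 0))) - 3 * X none * (X (some 1) + (l.val : (MvPolynomial (Option (Fin 4)) k)) * (X none ^ 6 * (X (some 0) * X none ^ ((![9, 2, 3] : Fin 3 → ℕ) 0 - ((![9,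 2, 3] : Fin 3 → ℕ) 1 + 6))))) ^ 2))) ^ dbar)) (some 0) (some 1) (some 2) (by decide) (by decide) (by decide) h2k hX2
    (fun o : Option (Fin 4) => o.elim (0 : k) ![0, 1, 1, 0]) rfl (by change ((![0, 1, 1, 0] : Fin 4 → k) 2) ^ 2 = ((![0, 1, 1, 0] : Fin 4 → k) 1) ^ 3; simp) hupt
  -- ### units of the localised model
  have hX1dvd : (X (some 1) : (MvPolynomial (Option (Fin 4)) k)) ∣ (cobordantAlgebra.subst k (![9, 2, 3, 0] : Fin 4 → ℕ) hh * (∏ l : ZMod p, (X (some 1) + (l.val : (MvPolynomial (Option (Fin 4)) k)) * (X none ^ 6 * (X (some 0) * X none ^ ((![9, 2, 3] : Fin 3 → ℕ) 0 - ((![9, 2, 3] : Fin 3 → ℕ) 1 + 6)))))) ^ n₁) * (((∏ l : ZMod p, (X (some 2) + (l.val : (MvPolynomial (Option (Fin 4)) k)) * (X none ^ 6 * X (some 0)))) * (∏ l : ZMod p, (2 * (X (some 2) + (l.val : (MvPolynomial (Option (Fin 4)) k)) * (X none ^ 6 * X (some 0))) - 3 * X none * (X (some 1) + (l.val : (MvPolynomial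 (Option (Fin 4)) k)) * (X none ^ 6 * (X (some 0) * X none ^ ((![9, 2, 3] : Fin 3 → ℕ) 0 - ((![9, 2, 3] : Fin 3 → ℕ) 1 + 6))))) ^ 2))) ^ dbar) := by
    have h := Finset.dvd_prod_of_mem (fun l : ZMod p => (X (some 1) + (l.val : (MvPolynomial (Option (Fin 4)) k)) * (X none ^ 6 * (X (some 0) * X none ^ ((![9, 2, 3] : Fin 3 → ℕ) 0 - ((![9, 2, 3] : Fin 3 → ℕ) 1 + 6))))))
      (Finset.mem_univ (0 : ZMod p))
    rw [ZMod.val_zero, Nat.cast_zero, zero_mul, add_zero] at h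
    exact ((h.trans (dvd_pow_self _ hn₁.ne')).trans (dvd_mul_left _ _)).trans (dvd_mul_right _ _)
  have hX2dvd : (X (some 2) : (MvPolynomial (Option (Fin 4)) k)) ∣ (cobordantAlgebra.subst k (![9, 2, 3, 0] : Fin 4 → ℕ) hh * (∏ l : ZMod p, (X (some 1) + (l.val : (MvPolynomial (Option (Fin 4)) k)) * (X none ^ 6 * (X (some 0) * X none ^ ((![9, 2, 3] : Fin 3 → ℕ) 0 - ((![9, 2, 3] : Fin 3 → ℕ) 1 + 6)))))) ^ n₁) * (((∏ l : ZMod p, (X (some 2) + (l.val : (MvPolynomial (Option (Fin 4)) k)) * (X none ^ 6 * X (some 0)))) * (∏ l : ZMod p, (2 * (X (some 2) + (l.val : (MvPolynomial (Option (Fin 4)) k)) * (X none ^ 6 * X (some 0))) - 3 * X none * (X (some 1) + (l.val : (MvPolynomial (Option (Fin 4)) k)) * (X none ^ 6 * (X (some 0) * X none ^ ((![9, 2, 3] : Fin 3 → ℕ) 0 - ((![9, 2, 3] : Fin 3 → ℕ) 1 + 6))))) ^ 2))) ^ dbar) := by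
    have h := Finset.dvd_prod_of_mem (fun l : ZMod p => (X (some 2) + (l.val : (MvPolynomial (Option (Fin 4)) k)) * (X none ^ 6 * X (some 0)))) (Finset.mem_univ (0 : ZMod p))
    rw [ZMod.val_zero, Nat.cast_zero, zero_mul, add_zero] at h
    exact h.trans hZP2dvd
  have hHUdvd : (2 * X (some 2) - 3 * X none * X (some 1) ^ 2 : MvPolynomial (Option (Fin 4)) k) ∣ (cobordantAlgebra.subst k (![9, 2, 3, 0] : Fin 4 → ℕ) hh * (∏ l : ZMod p, (X (some 1) + (l.val : (MvPolynomial (Option (Fin 4)) k)) * (X none ^ 6 * (X (some 0) * X none ^ ((![9, 2, 3] : Fin 3 → ℕ) 0 - ((![9, 2, 3] : Fin 3 → ℕ) 1 + 6)))))) ^ n₁) * (((∏ l : ZMod p, (X (some 2) + (l.val : (MvPolynomial (Option (Fin 4)) k)) * (X none ^ 6 * X (some 0)))) * (∏ l : ZMod p, (2 * (X (some 2) + (l.val : (MvPolynomial (Option (Fin 4)) k)) * (X none ^ 6 * X (some 0))) - 3 * X none * (X (some 1) + (l.val : (MvPolynomial (Option (Fin 4)) k)) * (X none ^ 6 * (X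 (some 0) * X none ^ ((![9, 2, 3] : Fin 3 → ℕ) 0 - ((![9, 2, 3] : Fin 3 → ℕ) 1 + 6))))) ^ 2))) ^ dbar) := by
    have h := Finset.dvd_prod_of_mem (fun l : ZMod p => (2 * (X (some 2) + (l.val : (MvPolynomial (Option (Fin 4)) k)) * (X none ^ 6 * X (some 0))) -
      3 * X none * (X (some 1) + (l.val : (MvPolynomial (Option (Fin 4)) k)) * (X none ^ 6 * (X (some 0) * X none ^ ((![9, 2, 3] : Fin 3 → ℕ) 0 - ((![9, 2, 3] : Fin 3 → ℕ) 1 + 6))))) ^ 2)) (Finset.mem_univ (0 : ZMod p))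
    rw [ZMod.val_zero, Nat.cast_zero, zero_mul, add_zero, zero_mul, add_zero] at h
    exact ((h.trans (dvd_mul_left (∏ l : ZMod p, (2 * (X (some 2) + (l.val : (MvPolynomial (Option (Fin 4)) k)) * (X none ^ 6 * X (some 0))) - 3 * X none * (X (some 1) + (l.val : (MvPolynomial (Option (Fin 4)) k)) * (X none ^ 6 * (X (some 0) * X none ^ ((![9, 2, 3] : Fin 3 → ℕ) 0 - ((![9, 2, 3] : Fin 3 → ℕ) 1 + 6))))) ^ 2)) (∏ l : ZMod p, (X (some 2) + (l.val : (MvPolynomial (Option (Fin 4)) k)) * (X none ^ 6 * X (some 0)))))).trans (dvd_pow_self _ hdbar.ne')).trans (dvd_mul_left _ _)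
  have hu1 := FreeModel.isUnit_algebraMap_of_dvd_mul (cobordantAlgebra.subst k (![9, 2, 3, 0] : Fin 4 → ℕ) hh * (∏ l : ZMod p, (X (some 1) + (l.val : (MvPolynomial (Option (Fin 4)) k)) * (X none ^ 6 * (X (some 0) * X none ^ ((![9, 2, 3] : Fin 3 → ℕ) 0 - ((![9, 2, 3] : Fin 3 → ℕ) 1 + 6)))))) ^ n₁) (((∏ l : ZMod p, (X (some 2) + (l.val : (MvPolynomial (Option (Fin 4)) k)) * (X none ^ 6 * X (some 0)))) * (∏ l : ZMod p, (2 * (X (some 2) + (l.val : (MvPolynomial (Option (Fin 4)) k)) * (X none ^ 6 * X (some 0))) - 3 * X none * (X (some 1) + (l.val : (MvPolynomial (Option (Fin 4)) k)) * (X none ^ 6 * (X (some 0) * X none ^ ((![9, 2, 3] : Fin 3 → ℕ) 0 - ((![9, 2, 3] : Fin 3 → ℕ) 1 + 6))))) ^ 2))) ^ dbar) hX1dvd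
  have hu2 := FreeModel.isUnit_algebraMap_of_dvd_mul (cobordantAlgebra.subst k (![9, 2, 3, 0] : Fin 4 → ℕ) hh * (∏ l : ZMod p, (X (some 1) + (l.val : (MvPolynomial (Option (Fin 4)) k)) * (X none ^ 6 * (X (some 0) * X none ^ ((![9, 2, 3] : Fin 3 → ℕ) 0 - ((![9, 2, 3] : Fin 3 → ℕ) 1 + 6)))))) ^ n₁) (((∏ l : ZMod p, (X (some 2) + (l.val : (MvPolynomial (Option (Fin 4)) k)) * (X none ^ 6 * X (some 0)))) * (∏ l : ZMod p, (2 * (X (some 2) + (l.val : (MvPolynomial (Option (Fin 4)) k)) * (X none ^ 6 * X (some 0))) - 3 * X none * (X (some 1) + (l.val : (MvPolynomial (Option (Fin 4)) k)) * (X none ^ 6 * (X (some 0) * X none ^ ((![9, 2, 3] : Fin 3 → ℕ) 0 - ((![9, 2, 3] : Fin 3 → ℕ) 1 + 6))))) ^ 2))) ^ dbar) hX2dvd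
  have hHU := FreeModel.isUnit_algebraMap_of_dvd_mul (cobordantAlgebra.subst k (![9, 2, 3, 0] : Fin 4 → ℕ) hh * (∏ l : ZMod p, (X (some 1) + (l.val : (MvPolynomial (Option (Fin 4)) k)) * (X none ^ 6 * (X (some 0) * X none ^ ((![9, 2, 3] : Fin 3 → ℕ) 0 - ((![9, 2, 3] : Fin 3 → ℕ) 1 + 6)))))) ^ n₁) (((∏ l : ZMod p, (X (some 2) + (l.val : (MvPolynomial (Option (Fin 4)) k)) * (X none ^ 6 * X (some 0)))) * (∏ l : ZMod p, (2 * (X (some 2) + (l.val : (MvPolynomial (Option (Fin 4)) k)) * (X none ^ 6 * X (some 0))) - 3 * X none * (X (some 1) + (l.val : (MvPolynomial (Option (Fin 4)) k)) * (X none ^ 6 * (X (some 0) * X none ^ ((![9, 2, 3] : Fin 3 → ℕ) 0 - ((![9, 2, 3] : Fin 3 → ℕ) 1 + 6))))) ^ 2))) ^ dbar) hHUdvd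
  have hQ₁ : IsUnit ((algebraMap (MvPolynomial (Option (Fin 4)) k) (Localization.Away ((cobordantAlgebra.subst k (![9, 2, 3, 0] : Fin 4 → ℕ) hh * (∏ l : ZMod p, (X (some 1) + (l.val : (MvPolynomial (Option (Fin 4)) k)) * (X none ^ 6 * (X (some 0) * X none ^ ((![9, 2, 3] : Fin 3 → ℕ) 0 - ((![9, 2, 3] : Fin 3 → ℕ) 1 + 6)))))) ^ n₁) * (((∏ l : ZMod p, (X (some 2) + (l.val : (MvPolynomial (Option (Fin 4)) k)) * (X none ^ 6 * X (some 0)))) * (∏ l : ZMod p, (2 * (X (some 2) + (l.val : (MvPolynomial (Option (Fin 4)) k)) * (X none ^ 6 * X (some 0))) - 3 * X none * (X (some 1) + (l.val : (MvPolynomial (Option (Fin 4)) k)) * (X none ^ 6 * (X (some 0) * X none ^ ((![9, 2, 3] : Fin 3 → ℕ) 0 - ((![9, 2, 3] : Fin 3 → ℕ) 1 + 6))))) ^ 2))) ^ dbar)))) (1 : (MvPolynomial (Option (Fin 4)) k))) := by rw [map_one]; exact isUnit_one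
  -- ### generators
  have hgen : Subring.closure (({(algebraMap (MvPolynomial (Option (Fin 4)) k) (Localization.Away ((cobordantAlgebra.subst k (![9, 2, 3, 0] : Fin 4 → ℕ) hh * (∏ l : ZMod p, (X (some 1) + (l.val : (MvPolynomial (Option (Fin 4)) k)) * (X none ^ 6 * (X (some 0) * X none ^ ((![9, 2, 3] : Fin 3 → ℕ) 0 - ((![9, 2, 3] : Fin 3 → ℕ) 1 + 6)))))) ^ n₁) * (((∏ l : ZMod p, (X (some 2) + (l.val : (MvPolynomial (Option (Fin 4)) k)) * (X none ^ 6 * X (some 0)))) * (∏ l : ZMod p, (2 * (X (some 2) + (l.val : (MvPolynomial (Option (Fin 4)) k)) * (X none ^ 6 * X (some 0))) - 3 * X none * (X (some 1) + (l.val : (MvPolynomial (Option (Fin 4)) k)) * (X none ^ 6 * (X (some 0) * X none ^ ((![9, 2, 3] : Fin 3 → ℕ) 0 - ((![9, 2, 3] : Fin 3 → ℕ) 1 + 6))))) ^ 2))) ^ dbar)))) (X none), (algebraMap (MvPolynomial (Option (Fin 4)) k) (Localization.Away ((cobordantAlgebra.subst k (![9, 2, 3, 0] : Fin 4 → ℕ)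 hh * (∏ l : ZMod p, (X (some 1) + (l.val : (MvPolynomial (Option (Fin 4)) k)) * (X none ^ 6 * (X (some 0) * X none ^ ((![9, 2, 3] : Fin 3 → ℕ) 0 - ((![9, 2, 3] : Fin 3 → ℕ) 1 + 6)))))) ^ n₁) * (((∏ l : ZMod p, (X (some 2) + (l.val : (MvPolynomial (Option (Fin 4)) k)) * (X none ^ 6 * X (some 0)))) * (∏ l : ZMod p, (2 * (X (some 2) + (l.val : (MvPolynomial (Option (Fin 4)) k)) * (X none ^ 6 * X (some 0))) - 3 * X none * (X (some 1) + (l.val : (MvPolynomial (Option (Fin 4)) k)) * (X none ^ 6 * (X (some 0) * X none ^ ((![9, 2, 3] : Fin 3 → ℕ) 0 - ((![9, 2, 3] : Fin 3 → ℕ) 1 + 6))))) ^ 2))) ^ dbar)))) (X (some 0)), (algebraMap (MvPolynomial (Option (Fin 4)) k) (Localization.Away ((cobordantAlgebra.subst k (![9, 2, 3, 0] : Fin 4 → ℕ) hh * (∏ l : ZMod p, (X (some 1) + (l.val : (MvPolynomial (Option (Fin 4)) k)) * (X none ^ 6 * (X (some 0) * X none ^ ((![9, 2, 3] : Fin 3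 → ℕ) 0 - ((![9, 2, 3] : Fin 3 → ℕ) 1 + 6)))))) ^ n₁) * (((∏ l : ZMod p, (X (some 2) + (l.val : (MvPolynomial (Option (Fin 4)) k)) * (X none ^ 6 * X (some 0)))) * (∏ l : ZMod p, (2 * (X (some 2) + (l.val : (MvPolynomial (Option (Fin 4)) k)) * (X none ^ 6 * X (some 0))) - 3 * X none * (X (some 1) + (l.val : (MvPolynomial (Option (Fin 4)) k)) * (X none ^ 6 * (X (some 0) * X none ^ ((![9, 2, 3] : Fin 3 → ℕ) 0 - ((![9, 2, 3] : Fin 3 → ℕ) 1 + 6))))) ^ 2))) ^ dbar)))) (X (some 2)), (algebraMap (MvPolynomial (Option (Fin 4)) k) (Localization.Away ((cobordantAlgebra.subst k (![9, 2, 3, 0] : Fin 4 → ℕ) hh * (∏ l : ZMod p, (X (some 1) + (l.val : (MvPolynomial (Option (Fin 4)) k)) * (X none ^ 6 * (X (some 0) * X none ^ ((![9, 2, 3] : Fin 3 → ℕ) 0 - ((![9, 2, 3] : Fin 3 → ℕ) 1 + 6)))))) ^ n₁) * (((∏ l : ZMod p, (X (some 2) + (l.val : (MvPolynomial (Option (Fin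 4)) k)) * (X none ^ 6 * X (some 0)))) * (∏ l : ZMod p, (2 * (X (some 2) + (l.val : (MvPolynomial (Option (Fin 4)) k)) * (X none ^ 6 * X (some 0))) - 3 * X none * (X (some 1) + (l.val : (MvPolynomial (Option (Fin 4)) k)) * (X none ^ 6 * (X (some 0) * X none ^ ((![9, 2, 3] : Fin 3 → ℕ) 0 - ((![9, 2, 3] : Fin 3 → ℕ) 1 + 6))))) ^ 2))) ^ dbar)))) (X (some 1)), (algebraMap (MvPolynomial (Option (Fin 4)) k) (Localization.Away ((cobordantAlgebra.subst k (![9, 2, 3, 0] : Fin 4 → ℕ) hh * (∏ l : ZMod p, (X (some 1) + (l.val : (MvPolynomial (Option (Fin 4)) k)) * (X none ^ 6 * (X (some 0) * X none ^ ((![9, 2, 3] : Fin 3 → ℕ) 0 - ((![9, 2, 3] : Fin 3 → ℕ) 1 + 6)))))) ^ n₁) * (((∏ l : ZMod p, (X (some 2) + (l.val : (MvPolynomial (Option (Fin 4)) k)) * (X none ^ 6 * X (some 0)))) * (∏ l : ZMod p, (2 * (X (some 2) + (l.val : (MvPolynomial (Option (Fin 4)) k)) * (X none ^ 6 * X (some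 0))) - 3 * X none * (X (some 1) + (l.val : (MvPolynomial (Option (Fin 4)) k)) * (X none ^ 6 * (X (some 0) * X none ^ ((![9, 2, 3] : Fin 3 → ℕ) 0 - ((![9, 2, 3] : Fin 3 → ℕ) 1 + 6))))) ^ 2))) ^ dbar)))) (X (some 3))} : Set (Localization.Away ((cobordantAlgebra.subst k (![9, 2, 3, 0] : Fin 4 → ℕ) hh * (∏ l : ZMod p, (X (some 1) + (l.val : (MvPolynomial (Option (Fin 4)) k)) * (X none ^ 6 * (X (some 0) * X none ^ ((![9, 2, 3] : Fin 3 → ℕ) 0 - ((![9, 2, 3] : Fin 3 → ℕ) 1 + 6)))))) ^ n₁) * (((∏ l : ZMod p, (X (some 2) + (l.val : (MvPolynomial (Option (Fin 4)) k)) * (X none ^ 6 * X (some 0)))) * (∏ l : ZMod p, (2 * (X (some 2) + (l.val : (MvPolynomial (Option (Fin 4)) k)) * (X none ^ 6 * X (some 0))) - 3 * X none * (X (some 1) + (l.val : (MvPolynomial (Option (Fin 4)) k)) * (X none ^ 6 * (X (some 0) * X none ^ ((![9, 2, 3] : Fin 3 → ℕ) 0 - ((![9, 2, 3] : Fin 3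 → ℕ) 1 + 6))))) ^ 2))) ^ dbar)))) ∪ (({IsLocalization.Away.invSelf ((cobordantAlgebra.subst k (![9, 2, 3, 0] : Fin 4 → ℕ) hh * (∏ l : ZMod p, (X (some 1) + (l.val : (MvPolynomial (Option (Fin 4)) k)) * (X none ^ 6 * (X (some 0) * X none ^ ((![9, 2, 3] : Fin 3 → ℕ) 0 - ((![9, 2, 3] : Fin 3 → ℕ) 1 + 6)))))) ^ n₁) * (((∏ l : ZMod p, (X (some 2) + (l.val : (MvPolynomial (Option (Fin 4)) k)) * (X none ^ 6 * X (some 0)))) * (∏ l : ZMod p, (2 * (X (some 2) + (l.val : (MvPolynomial (Option (Fin 4)) k)) * (X none ^ 6 * X (some 0))) - 3 * X none * (X (some 1) + (l.val : (MvPolynomial (Option (Fin 4)) k)) * (X none ^ 6 * (X (some 0) * X none ^ ((![9, 2, 3] : Fin 3 → ℕ) 0 - ((![9, 2, 3] : Fin 3 → ℕ) 1 + 6))))) ^ 2))) ^ dbar))} : Set (Localization.Away ((cobordantAlgebra.subst k (![9, 2, 3, 0] : Fin 4 → ℕ) hh * (∏ l : ZMod p, (X (some 1) + (l.val : (MvPolynomial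 (Option (Fin 4)) k)) * (X none ^ 6 * (X (some 0) * X none ^ ((![9, 2, 3] : Fin 3 → ℕ) 0 - ((![9, 2, 3] : Fin 3 → ℕ) 1 + 6)))))) ^ n₁) * (((∏ l : ZMod p, (X (some 2) + (l.val : (MvPolynomial (Option (Fin 4)) k)) * (X none ^ 6 * X (some 0)))) * (∏ l : ZMod p, (2 * (X (some 2) + (l.val : (MvPolynomial (Option (Fin 4)) k)) * (X none ^ 6 * X (some 0))) - 3 * X none * (X (some 1) + (l.val : (MvPolynomial (Option (Fin 4)) k)) * (X none ^ 6 * (X (some 0) * X none ^ ((![9, 2, 3] : Fin 3 → ℕ) 0 - ((![9, 2, 3] : Fin 3 → ℕ) 1 + 6))))) ^ 2))) ^ dbar)))) ∪ Set.range (algebraMap k (Localization.Away ((cobordantAlgebra.subst k (![9, 2, 3, 0] : Fin 4 → ℕ) hh * (∏ l : ZMod p, (X (some 1) + (l.val : (MvPolynomial (Option (Fin 4)) k)) * (X none ^ 6 * (X (some 0) * X none ^ ((![9, 2, 3] : Fin 3 → ℕ) 0 - ((![9, 2, 3] : Fin 3 → ℕ) 1 + 6)))))) ^ n₁) * (((∏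 l : ZMod p, (X (some 2) + (l.val : (MvPolynomial (Option (Fin 4)) k)) * (X none ^ 6 * X (some 0)))) * (∏ l : ZMod p, (2 * (X (some 2) + (l.val : (MvPolynomial (Option (Fin 4)) k)) * (X none ^ 6 * X (some 0))) - 3 * X none * (X (some 1) + (l.val : (MvPolynomial (Option (Fin 4)) k)) * (X none ^ 6 * (X (some 0) * X none ^ ((![9, 2, 3] : Fin 3 → ℕ) 0 - ((![9, 2, 3] : Fin 3 → ℕ) 1 + 6))))) ^ 2))) ^ dbar)))))) = ⊤ := by
    rw [Set.insert_comm ((algebraMap (MvPolynomial (Option (Fin 4)) k) (Localization.Away ((cobordantAlgebra.subst k (![9, 2, 3, 0] : Fin 4 → ℕ) hh * (∏ l : ZMod p, (X (some 1) + (l.val : (MvPolynomial (Option (Fin 4)) k)) * (X none ^ 6 * (X (some 0) * X none ^ ((![9, 2, 3] : Fin 3 → ℕ) 0 - ((![9, 2, 3] : Fin 3 → ℕ) 1 + 6)))))) ^ n₁) * (((∏ l : ZMod p, (X (some 2) + (l.val : (MvPolynomial (Option (Fin 4)) k)) * (X none ^ 6 * X (some 0)))) * (∏ l : ZMod p, (2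 * (X (some 2) + (l.val : (MvPolynomial (Option (Fin 4)) k)) * (X none ^ 6 * X (some 0))) - 3 * X none * (X (some 1) + (l.val : (MvPolynomial (Option (Fin 4)) k)) * (X none ^ 6 * (X (some 0) * X none ^ ((![9, 2, 3] : Fin 3 → ℕ) 0 - ((![9, 2, 3] : Fin 3 → ℕ) 1 + 6))))) ^ 2))) ^ dbar)))) (X (some 2))) ((algebraMap (MvPolynomial (Option (Fin 4)) k) (Localization.Away ((cobordantAlgebra.subst k (![9, 2, 3, 0] : Fin 4 → ℕ) hh * (∏ l : ZMod p, (X (some 1) + (l.val : (MvPolynomial (Option (Fin 4)) k)) * (X none ^ 6 * (X (some 0) * X none ^ ((![9, 2, 3] : Fin 3 → ℕ) 0 - ((![9, 2, 3] : Fin 3 → ℕ) 1 + 6)))))) ^ n₁) * (((∏ l : ZMod p, (X (some 2) + (l.val : (MvPolynomial (Option (Fin 4)) k)) * (X none ^ 6 * X (some 0)))) * (∏ l : ZMod p, (2 * (X (some 2) + (l.val : (MvPolynomial (Option (Fin 4)) k)) * (X none ^ 6 * X (some 0))) - 3 * X none * (X (some 1) + (l.val : (MvPolynomial (Option (Fin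 4)) k)) * (X none ^ 6 * (X (some 0) * X none ^ ((![9, 2, 3] : Fin 3 → ℕ) 0 - ((![9, 2, 3] : Fin 3 → ℕ) 1 + 6))))) ^ 2))) ^ dbar)))) (X (some 1)))]
    exact A1.a1_model_closure_eq_top _
  -- ### degrees
  have dX0 := KillCert.QhAway.qhc_degree_u' (![9, 2, 3] : Fin 3 → ℕ) hh mo 𝒜 hf y hy Φ hΦu 0
  have dX1 := KillCert.QhAway.qhc_degree_u' (![9, 2, 3] : Fin 3 → ℕ) hh mo 𝒜 hf y hy Φ hΦu 1
  have dX2 := KillCert.QhAway.qhc_degree_u' (![9, 2, 3] : Fin 3 → ℕ) hh mo 𝒜 hf y hy Φ hΦu 2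
  have dφ : (algebraMap (MvPolynomial (Option (Fin 4)) k) (Localization.Away (cobordantAlgebra.subst k (![9, 2, 3, 0] : Fin 4 → ℕ) hh * (∏ l : ZMod p, (X (some 1) + (l.val : (MvPolynomial (Option (Fin 4)) k)) * (X none ^ 6 * (X (some 0) * X none ^ ((![9, 2, 3] : Fin 3 → ℕ) 0 - ((![9, 2, 3] : Fin 3 → ℕ) 1 + 6)))))) ^ n₁))) (X (some 2) ^ 2 - X (some 1) ^ 3 : MvPolynomial (Option (Fin 4)) k) ∈ mapGrading (chartNodeGrading mo 𝒜 (fun i => algebraMap (MvPolynomial (Fin 4) k) (Localization.Away hh) (X ((![0, 1, 2] : Fin 3 → Fin 4) i))) (![9, 2, 3] : Fin 3 → ℕ) hf dbar y hy) Φ (6 • (consIndexEquiv mo ((1 : ℤ), (0 : Π j : Fin mg, ZMod (mo j))))) := by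
    rw [← hφeq]; exact KillCert.QhAway.qhc_degree_tail (X 2 ^ 2 - X 1 ^ 3) (![9, 2, 3] : Fin 3 → ℕ) 6 hh mo 𝒜 hf y hy Φ ht (hfull 0 _)
  have hX₀d : (algebraMap (MvPolynomial (Option (Fin 4)) k) (Localization.Away (cobordantAlgebra.subst k (![9, 2, 3, 0] : Fin 4 → ℕ) hh * (∏ l : ZMod p, (X (some 1) + (l.val : (MvPolynomial (Option (Fin 4)) k)) * (X none ^ 6 * (X (some 0) * X none ^ ((![9, 2, 3] : Fin 3 → ℕ) 0 - ((![9, 2, 3] : Fin 3 → ℕ) 1 + 6)))))) ^ n₁))) (X (some 0)) ∈ mapGrading (chartNodeGrading mo 𝒜 (fun i => algebraMap (MvPolynomial (Fin 4) k) (Localization.Away hh) (X ((![0, 1, 2] : Fin 3 → Fin 4) i))) (![9, 2, 3] : Fin 3 → ℕ) hf dbar y hy) Φ (3 • ((((![9, 2, 3] : Fin 3 → ℕ) 2 : ℕ)) • (consIndexEquiv mo ((1 : ℤ), (0 : Π j : Fin mg, ZMod (mo j)))))) := by rw [smul_smul]; exact dX0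
  have hφd : (algebraMap (MvPolynomial (Option (Fin 4)) k) (Localization.Away (cobordantAlgebra.subst k (![9, 2, 3, 0] : Fin 4 → ℕ) hh * (∏ l : ZMod p, (X (some 1) + (l.val : (MvPolynomial (Option (Fin 4)) k)) * (X none ^ 6 * (X (some 0) * X none ^ ((![9, 2, 3] : Fin 3 → ℕ) 0 - ((![9, 2, 3] : Fin 3 → ℕ) 1 + 6)))))) ^ n₁))) (X (some 2) ^ 2 - X (some 1) ^ 3 : MvPolynomial (Option (Fin 4)) k) ∈ mapGrading (chartNodeGrading mo 𝒜 (fun i => algebraMap (MvPolynomial (Fin 4) k) (Localization.Away hh) (X ((![0, 1, 2] : Fin 3 → Fin 4) i))) (![9, 2, 3] : Fin 3 → ℕ) hf dbar y hy) Φ (3 • ((((![9, 2, 3] : Fin 3 → ℕ) 1 : ℕ)) • (consIndexEquiv mo ((1 : ℤ), (0 : Π j : Fin mg, ZMod (mo j)))))) := by rw [smul_smul]; exact dφ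
  -- ### rows in the shape of the abstract member theorem
  have h1' : conj Φ (sigmaChart 𝒜 (fun i => algebraMap (MvPolynomial (Fin 4) k) (Localization.Away hh) (X ((![0, 1, 2] : Fin 3 → Fin 4) i))) (![9, 2, 3] : Fin 3 → ℕ) dbar y hy (sigmaAway σ hσh) hσJ hp hσpL hσy) ((algebraMap (MvPolynomial (Option (Fin 4)) k) (Localization.Away (cobordantAlgebra.subst k (![9, 2, 3, 0] : Fin 4 → ℕ) hh * (∏ l : ZMod p, (X (some 1) + (l.val : (MvPolynomial (Option (Fin 4)) k)) * (X none ^ 6 * (X (some 0) * X none ^ ((![9, 2, 3] : Fin 3 → ℕ) 0 - ((![9, 2, 3] : Fin 3 → ℕ) 1 + 6)))))) ^ n₁))) (X (some 2))) = (algebraMap (MvPolynomial (Option (Fin 4)) k) (Localization.Away (cobordantAlgebra.subst k (![9, 2, 3, 0] : Fin 4 → ℕ) hh * (∏ l : ZMod p, (X (some 1) + (l.val : (MvPolynomial (Option (Fin 4)) k)) * (X none ^ 6 * (X (some 0) * X none ^ ((![9, 2, 3] : Fin 3 → ℕ) 0 - ((![9, 2, 3] : Fin 3 → ℕ) 1 +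 6)))))) ^ n₁))) (X (some 2) + 1 * (X none ^ 6 * X (some 0))) := by
    rw [row2]; simp only [map_add, map_mul, map_pow, one_mul]
  have h2' : conj Φ (sigmaChart 𝒜 (fun i => algebraMap (MvPolynomial (Fin 4) k) (Localization.Away hh) (X ((![0, 1, 2] : Fin 3 → Fin 4) i))) (![9, 2, 3] : Fin 3 → ℕ) dbar y hy (sigmaAway σ hσh) hσJ hp hσpL hσy) ((algebraMap (MvPolynomial (Option (Fin 4)) k) (Localization.Away (cobordantAlgebra.subst k (![9, 2, 3, 0] : Fin 4 → ℕ) hh * (∏ l : ZMod p, (X (some 1) + (l.val : (MvPolynomial (Option (Fin 4)) k)) * (X none ^ 6 * (X (some 0) * X none ^ ((![9, 2, 3] : Fin 3 → ℕ) 0 - ((![9, 2, 3] : Fin 3 → ℕ) 1 + 6)))))) ^ n₁))) (X (some 1))) = (algebraMap (MvPolynomial (Option (Fin 4)) k) (Localization.Away (cobordantAlgebra.subst k (![9, 2, 3, 0] : Fin 4 → ℕ) hh * (∏ l : ZMod p, (X (some 1) + (l.val : (MvPolynomial (Option (Fin 4)) k)) * (X none ^ 6 * (X (some 0) * X none ^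 ((![9, 2, 3] : Fin 3 → ℕ) 0 - ((![9, 2, 3] : Fin 3 → ℕ) 1 + 6)))))) ^ n₁))) (X (some 1) + X none * (X none ^ 6 * X (some 0))) := by
    rw [row1, he1]; simp only [map_add, map_mul, map_pow, pow_one]; ring
  have h3' : conj Φ (sigmaChart 𝒜 (fun i => algebraMap (MvPolynomial (Fin 4) k) (Localization.Away hh) (X ((![0, 1, 2] : Fin 3 → Fin 4) i))) (![9, 2, 3] : Fin 3 → ℕ) dbar y hy (sigmaAway σ hσh) hσJ hp hσpL hσy) ((algebraMap (MvPolynomial (Option (Fin 4)) k) (Localization.Away (cobordantAlgebra.subst k (![9, 2, 3, 0] : Fin 4 → ℕ) hh * (∏ l : ZMod p, (X (some 1) + (l.val : (MvPolynomial (Option (Fin 4)) k)) * (X none ^ 6 * (X (some 0) * X none ^ ((![9, 2, 3] : Fin 3 → ℕ) 0 - ((![9, 2, 3] : Fin 3 → ℕ) 1 + 6)))))) ^ n₁))) (X (some 3))) = (algebraMap (MvPolynomial (Option (Fin 4)) k) (Localization.Away (cobordantAlgebra.subst k (![9, 2, 3, 0] : Fin 4 → ℕ) hh * (∏ l : ZMod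 p, (X (some 1) + (l.val : (MvPolynomial (Option (Fin 4)) k)) * (X none ^ 6 * (X (some 0) * X none ^ ((![9, 2, 3] : Fin 3 → ℕ) 0 - ((![9, 2, 3] : Fin 3 → ℕ) 1 + 6)))))) ^ n₁))) (X (some 3) + X none ^ 6 * (X (some 2) ^ 2 - X (some 1) ^ 3 : MvPolynomial (Option (Fin 4)) k)) := by rw [row3, map_add, map_mul, map_pow]
  have hφ' : conj Φ (sigmaChart 𝒜 (fun i => algebraMap (MvPolynomial (Fin 4) k) (Localization.Away hh) (X ((![0, 1, 2] : Fin 3 → Fin 4) i))) (![9, 2, 3] : Fin 3 → ℕ) dbar y hy (sigmaAway σ hσh) hσJ hp hσpL hσy) ((algebraMap (MvPolynomial (Option (Fin 4)) k) (Localization.Away (cobordantAlgebra.subst k (![9, 2, 3, 0] : Fin 4 → ℕ) hh * (∏ l : ZMod p, (X (some 1) + (l.val : (MvPolynomial (Option (Fin 4)) k)) * (X none ^ 6 * (X (some 0) * X none ^ ((![9, 2, 3] : Fin 3 → ℕ) 0 - ((![9, 2, 3] : Fin 3 → ℕ) 1 + 6)))))) ^ n₁))) (X (some 2) ^ 2 -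 X (some 1) ^ 3 : MvPolynomial (Option (Fin 4)) k)) = (algebraMap (MvPolynomial (Option (Fin 4)) k) (Localization.Away (cobordantAlgebra.subst k (![9, 2, 3, 0] : Fin 4 → ℕ) hh * (∏ l : ZMod p, (X (some 1) + (l.val : (MvPolynomial (Option (Fin 4)) k)) * (X none ^ 6 * (X (some 0) * X none ^ ((![9, 2, 3] : Fin 3 → ℕ) 0 - ((![9, 2, 3] : Fin 3 → ℕ) 1 + 6)))))) ^ n₁))) ((X (some 2) ^ 2 - X (some 1) ^ 3 : MvPolynomial (Option (Fin 4)) k) + X none ^ 6 * X (some 0) * (2 * X (some 2) - 3 * X none * X (some 1) ^ 2 : MvPolynomial (Option (Fin 4)) k) + (X none ^ 6 * X (some 0)) ^ 2 * (1 - 3 * X none ^ 2 * X (some 1) - X none ^ 9 * X (some 0) : MvPolynomial (Option (Fin 4)) k)) := by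
    have e : (algebraMap (MvPolynomial (Option (Fin 4)) k) (Localization.Away (cobordantAlgebra.subst k (![9, 2, 3, 0] : Fin 4 → ℕ) hh * (∏ l : ZMod p, (X (some 1) + (l.val : (MvPolynomial (Option (Fin 4)) k)) * (X none ^ 6 * (X (some 0) * X none ^ ((![9, 2, 3] : Fin 3 → ℕ) 0 - ((![9, 2, 3] : Fin 3 → ℕ) 1 + 6)))))) ^ n₁))) (X (some 2) ^ 2 - X (some 1) ^ 3 : MvPolynomial (Option (Fin 4)) k) = (algebraMap (MvPolynomial (Option (Fin 4)) k) (Localization.Away (cobordantAlgebra.subst k (![9, 2, 3, 0] : Fin 4 → ℕ) hh * (∏ l : ZMod p, (X (some 1) + (l.val : (MvPolynomial (Option (Fin 4)) k)) * (X none ^ 6 * (X (some 0) * X none ^ ((![9, 2, 3] : Fin 3 → ℕ) 0 - ((![9, 2, 3] : Fin 3 → ℕ) 1 + 6)))))) ^ n₁))) (X (some 2)) ^ 2 - (algebraMap (MvPolynomial (Option (Fin 4)) k) (Localization.Away (cobordantAlgebra.subst k (![9, 2, 3, 0] : Fin 4 → ℕ) hh * (∏ l : ZMod p, (X (some 1)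 + (l.val : (MvPolynomial (Option (Fin 4)) k)) * (X none ^ 6 * (X (some 0) * X none ^ ((![9, 2, 3] : Fin 3 → ℕ) 0 - ((![9, 2, 3] : Fin 3 → ℕ) 1 + 6)))))) ^ n₁))) (X (some 1)) ^ 3 := by simp only [map_sub, map_pow]
    rw [e, map_sub, map_pow, map_pow, row2, row1, he1]
    simp only [map_add, map_sub, map_mul, map_pow, map_one, map_ofNat, pow_one]
    ring
  have hXR : (X (some 2) ^ 2 - X (some 1) ^ 3 : MvPolynomial (Option (Fin 4)) k) = 1 * (X (some 2) ^ 2 - X (some 1) ^ 3 : MvPolynomial (Option (Fin 4)) k) := (one_mul _).symm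
  -- ### the member on `D(b)`, presented by sections
  obtain ⟨a', bb, ha', hbb', d₀, hd₀, hK⟩ := exists_memberSections_away₂ hG M W
    ({ affine := hW, m := mg + 1, r := Fin.cons 0 mo, B := (ChartRing 𝒜 (fun i => algebraMap (MvPolynomial (Fin 4) k) (Localization.Away hh) (X ((![0, 1, 2] : Fin 3 → Fin 4) i))) (![9, 2, 3] : Fin 3 → ℕ) dbar y hy), 𝒜 := (chartNodeGrading mo 𝒜 (fun i => algebraMap (MvPolynomial (Fin 4) k) (Localization.Away hh) (X ((![0, 1, 2] : Fin 3 → Fin 4) i))) (![9, 2, 3] : Fin 3 → ℕ) hf dbar y hy), σ := (sigmaChart 𝒜 (fun i => algebraMap (MvPolynomial (Fin 4) k) (Localization.Away hh) (X ((![0, 1, 2] : Fin 3 → Fin 4) i))) (![9, 2, 3] : Fin 3 → ℕ) dbar y hy (sigmaAway σ hσh) hσJ hp hσpL hσy), e := E, tame := htame, intertwine := hE } : NodeData p M.act g₀ W)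
    (cobordantAlgebra.subst k (![9, 2, 3, 0] : Fin 4 → ℕ) hh * (∏ l : ZMod p, (X (some 1) + (l.val : (MvPolynomial (Option (Fin 4)) k)) * (X none ^ 6 * (X (some 0) * X none ^ ((![9, 2, 3] : Fin 3 → ℕ) 0 - ((![9, 2, 3] : Fin 3 → ℕ) 1 + 6)))))) ^ n₁) (((∏ l : ZMod p, (X (some 2) + (l.val : (MvPolynomial (Option (Fin 4)) k)) * (X none ^ 6 * X (some 0)))) * (∏ l : ZMod p, (2 * (X (some 2) + (l.val : (MvPolynomial (Option (Fin 4)) k)) * (X none ^ 6 * X (some 0))) - 3 * X none * (X (some 1) + (l.val : (MvPolynomial (Option (Fin 4)) k)) * (X none ^ 6 * (X (some 0) * X none ^ ((![9, 2, 3] : Fin 3 → ℕ) 0 - ((![9, 2, 3] : Fin 3 → ℕ) 1 + 6))))) ^ 2))) ^ dbar) Φ b hσbE Φ' hpin (X (some 2)) (X (some 1)) (X (some 2) ^ 2 - X (some 1) ^ 3 : MvPolynomial (Option (Fin 4)) k) (X (some 2) ^ 2 - X (some 1) ^ 3 : MvPolynomial (Option (Fin 4)) k) 1 1 (X none) (2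 * X (some 2) - 3 * X none * X (some 1) ^ 2 : MvPolynomial (Option (Fin 4)) k) (1 - 3 * X none ^ 2 * X (some 1) - X none ^ 9 * X (some 0) : MvPolynomial (Option (Fin 4)) k) 6
    rn row0 h1' h2' h3' hφ' rC hτq hXR hQ₁ hHU hQ₁ hgen hK1 hK1' (((![9, 2, 3] : Fin 3 → ℕ) 2 : ℕ) • (consIndexEquiv mo ((1 : ℤ), (0 : Π j : Fin mg, ZMod (mo j))))) (((![9, 2, 3] : Fin 3 → ℕ) 1 : ℕ) • (consIndexEquiv mo ((1 : ℤ), (0 : Π j : Fin mg, ZMod (mo j))))) 3 3 (X (some 2)) (X (some 1)) hu2 hu1 dX2 dX1 hX₀d hφd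
  -- ### relations with the pulled-back root sections (✓`memberSection_relation`)
  have hEr0 : Φ ((E r0 : ↥((chartNodeGrading mo 𝒜 (fun i => algebraMap (MvPolynomial (Fin 4) k) (Localization.Away hh) (X ((![0, 1, 2] : Fin 3 → Fin 4) i))) (![9, 2, 3] : Fin 3 → ℕ) hf dbar y hy) 0)) : (ChartRing 𝒜 (fun i => algebraMap (MvPolynomial (Fin 4) k) (Localization.Away hh) (X ((![0, 1, 2] : Fin 3 → Fin 4) i))) (![9, 2, 3] : Fin 3 → ℕ) dbar y hy)) = (algebraMap (MvPolynomial (Option (Fin 4)) k) (Localization.Away (cobordantAlgebra.subst k (![9, 2, 3, 0] : Fin 4 → ℕ) hh * (∏ l : ZMod p, (X (some 1) + (l.val : (MvPolynomial (Option (Fin 4)) k)) * (X none ^ 6 * (X (some 0) * X none ^ ((![9, 2, 3] : Fin 3 → ℕ) 0 - ((![9, 2, 3] : Fin 3 → ℕ) 1 + 6)))))) ^ n₁))) (X none ^ 9 * X (some 0)) := by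
    rw [hr0]; refine (hΦa (X 0)).trans ?_; rw [hsubX]; rfl
  have hEr1 : Φ ((E r1 : ↥((chartNodeGrading mo 𝒜 (fun i => algebraMap (MvPolynomial (Fin 4) k) (Localization.Away hh) (X ((![0, 1, 2] : Fin 3 → Fin 4) i))) (![9, 2, 3] : Fin 3 → ℕ) hf dbar y hy) 0)) : (ChartRing 𝒜 (fun i => algebraMap (MvPolynomial (Fin 4) k) (Localization.Away hh) (X ((![0, 1, 2] : Fin 3 → Fin 4) i))) (![9, 2, 3] : Fin 3 → ℕ) dbar y hy)) = (algebraMap (MvPolynomial (Option (Fin 4)) k) (Localization.Away (cobordantAlgebra.subst k (![9, 2, 3, 0] : Fin 4 → ℕ) hh * (∏ l : ZMod p, (X (some 1) + (l.val : (MvPolynomial (Option (Fin 4)) k)) * (X none ^ 6 * (X (some 0) * X none ^ ((![9, 2, 3] : Fin 3 → ℕ) 0 - ((![9, 2, 3] : Fin 3 → ℕ) 1 + 6)))))) ^ n₁))) (X none ^ 2 * X (some 1)) := by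
    rw [hr1]; refine (hΦa (X 1)).trans ?_; rw [hsubX]; rfl
  have hEr2 : Φ ((E r2 : ↥((chartNodeGrading mo 𝒜 (fun i => algebraMap (MvPolynomial (Fin 4) k) (Localization.Away hh) (X ((![0, 1, 2] : Fin 3 → Fin 4) i))) (![9, 2, 3] : Fin 3 → ℕ) hf dbar y hy) 0)) : (ChartRing 𝒜 (fun i => algebraMap (MvPolynomial (Fin 4) k) (Localization.Away hh) (X ((![0, 1, 2] : Fin 3 → Fin 4) i))) (![9, 2, 3] : Fin 3 → ℕ) dbar y hy)) = (algebraMap (MvPolynomial (Option (Fin 4)) k) (Localization.Away (cobordantAlgebra.subst k (![9, 2, 3, 0] : Fin 4 → ℕ) hh * (∏ l : ZMod p, (X (some 1) + (l.val : (MvPolynomial (Option (Fin 4)) k)) * (X none ^ 6 * (X (some 0) * X none ^ ((![9, 2, 3] : Fin 3 → ℕ) 0 - ((![9, 2, 3] : Fin 3 → ℕ) 1 + 6)))))) ^ n₁))) (X none ^ 3 * X (some 2)) := by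
    rw [hr2]; refine (hΦa (X 2)).trans ?_; rw [hsubX]; rfl
  have hErt : Φ ((E rt : ↥((chartNodeGrading mo 𝒜 (fun i => algebraMap (MvPolynomial (Fin 4) k) (Localization.Away hh) (X ((![0, 1, 2] : Fin 3 → Fin 4) i))) (![9, 2, 3] : Fin 3 → ℕ) hf dbar y hy) 0)) : (ChartRing 𝒜 (fun i => algebraMap (MvPolynomial (Fin 4) k) (Localization.Away hh) (X ((![0, 1, 2] : Fin 3 → Fin 4) i))) (![9, 2, 3] : Fin 3 → ℕ) dbar y hy)) = (algebraMap (MvPolynomial (Option (Fin 4)) k) (Localization.Away (cobordantAlgebra.subst k (![9, 2, 3, 0] : Fin 4 → ℕ) hh * (∏ l : ZMod p, (X (some 1) + (l.val : (MvPolynomial (Option (Fin 4)) k)) * (X none ^ 6 * (X (some 0) * X none ^ ((![9, 2, 3] : Fin 3 → ℕ) 0 - ((![9, 2, 3] : Fin 3 → ℕ) 1 + 6)))))) ^ n₁))) (X none ^ 6 * (X (some 2) ^ 2 - X (some 1) ^ 3 : MvPolynomial (Option (Fin 4)) k)) := by rw [hrt, hΦa, hT']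
  have hrel_a := memberSection_relation M W
    ({ affine := hW, m := mg + 1, r := Fin.cons 0 mo, B := (ChartRing 𝒜 (fun i => algebraMap (MvPolynomial (Fin 4) k) (Localization.Away hh) (X ((![0, 1, 2] : Fin 3 → Fin 4) i))) (![9, 2, 3] : Fin 3 → ℕ) dbar y hy), 𝒜 := (chartNodeGrading mo 𝒜 (fun i => algebraMap (MvPolynomial (Fin 4) k) (Localization.Away hh) (X ((![0, 1, 2] : Fin 3 → Fin 4) i))) (![9, 2, 3] : Fin 3 → ℕ) hf dbar y hy), σ := (sigmaChart 𝒜 (fun i => algebraMap (MvPolynomial (Fin 4) k) (Localization.Away hh) (X ((![0, 1, 2] : Fin 3 → Fin 4) i))) (![9, 2, 3] : Fin 3 → ℕ) dbar y hy (sigmaAway σ hσh) hσJ hp hσpL hσy), e := E, tame := htame, intertwine := hE } : NodeData p M.act g₀ W)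
    (cobordantAlgebra.subst k (![9, 2, 3, 0] : Fin 4 → ℕ) hh * (∏ l : ZMod p, (X (some 1) + (l.val : (MvPolynomial (Option (Fin 4)) k)) * (X none ^ 6 * (X (some 0) * X none ^ ((![9, 2, 3] : Fin 3 → ℕ) 0 - ((![9, 2, 3] : Fin 3 → ℕ) 1 + 6)))))) ^ n₁) (((∏ l : ZMod p, (X (some 2) + (l.val : (MvPolynomial (Option (Fin 4)) k)) * (X none ^ 6 * X (some 0)))) * (∏ l : ZMod p, (2 * (X (some 2) + (l.val : (MvPolynomial (Option (Fin 4)) k)) * (X none ^ 6 * X (some 0))) - 3 * X none * (X (some 1) + (l.val : (MvPolynomial (Option (Fin 4)) k)) * (X none ^ 6 * (X (some 0) * X none ^ ((![9, 2, 3] : Fin 3 → ℕ) 0 - ((![9, 2, 3] : Fin 3 → ℕ) 1 + 6))))) ^ 2))) ^ dbar) Φ b Φ' hpin2 a' (X (some 2)) (X (some 0)) 3 ha' r2 r0 (X none ^ 3 * X (some 2)) (X none ^ 9 * X (some 0)) (X none ^ 9) hEr2 hEr0 (by ring) (by ring)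
  have hrel_b := memberSection_relation M W
    ({ affine := hW, m := mg + 1, r := Fin.cons 0 mo, B := (ChartRing 𝒜 (fun i => algebraMap (MvPolynomial (Fin 4) k) (Localization.Away hh) (X ((![0, 1, 2] : Fin 3 → Fin 4) i))) (![9, 2, 3] : Fin 3 → ℕ) dbar y hy), 𝒜 := (chartNodeGrading mo 𝒜 (fun i => algebraMap (MvPolynomial (Fin 4) k) (Localization.Away hh) (X ((![0, 1, 2] : Fin 3 → Fin 4) i))) (![9, 2, 3] : Fin 3 → ℕ) hf dbar y hy), σ := (sigmaChart 𝒜 (fun i => algebraMap (MvPolynomial (Fin 4) k) (Localization.Away hh) (X ((![0, 1, 2] : Fin 3 → Fin 4) i))) (![9, 2, 3] : Fin 3 → ℕ) dbar y hy (sigmaAway σ hσh) hσJ hp hσpL hσy), e := E, tame := htame, intertwine := hE } : NodeData p M.act g₀ W)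
    (cobordantAlgebra.subst k (![9, 2, 3, 0] : Fin 4 → ℕ) hh * (∏ l : ZMod p, (X (some 1) + (l.val : (MvPolynomial (Option (Fin 4)) k)) * (X none ^ 6 * (X (some 0) * X none ^ ((![9, 2, 3] : Fin 3 → ℕ) 0 - ((![9, 2, 3] : Fin 3 → ℕ) 1 + 6)))))) ^ n₁) (((∏ l : ZMod p, (X (some 2) + (l.val : (MvPolynomial (Option (Fin 4)) k)) * (X none ^ 6 * X (some 0)))) * (∏ l : ZMod p, (2 * (X (some 2) + (l.val : (MvPolynomial (Option (Fin 4)) k)) * (X none ^ 6 * X (some 0))) - 3 * X none * (X (some 1) + (l.val : (MvPolynomial (Option (Fin 4)) k)) * (X none ^ 6 * (X (some 0) * X none ^ ((![9, 2, 3] : Fin 3 → ℕ) 0 - ((![9, 2, 3] : Fin 3 → ℕ) 1 + 6))))) ^ 2))) ^ dbar) Φ b Φ' hpin2 bb (X (some 1)) (X (some 2) ^ 2 - X (some 1) ^ 3 : MvPolynomial (Option (Fin 4)) k) 3 hbb' r1 rt (X none ^ 2 * X (some 1)) (X none ^ 6 * (X (some 2) ^ 2 - X (some 1) ^ 3 :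 MvPolynomial (Option (Fin 4)) k)) (X none ^ 6) hEr1 hErt (by ring) (by ring)
  exact ⟨b, _, M.V.basicOpen_le b, rfl, hEb, a', bb, hrel_a, hrel_b, d₀, hd₀, hK⟩

end Summit.ResolutionOfSingularities.ResolutionOfSingularities.Theorems.WildQuotientResolution.S1.GameFrame.GModel

end
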